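import Literature.NumberTheory.LFunctions.ClassGroupLFunctionConvexity
import Literature.NumberTheory.LFunctions.DirichletMVTSharp
import Literature.NumberTheory.Sieve.DivisorBound
import Literature.Analysis.Complex.CahenMellinDirichlet
import Literature.Analysis.Complex.MellinBarnesShift
import Literature.Analysis.SpecialFunctions.GammaVerticalRatio
import Literature.Analysis.SpecialFunctions.GammaVerticalBounds
import Mathlib.NumberTheory.ArithmeticFunction.Misc
import HarnessLib

/-!
# The mean square of the class-twisted zeta functions of an imaginary quadratic field in the
# strip `1/2 < σ < 1`

Topic `Literature/NumberTheory/LFunctions` (namespace `Literature.NumberTheory.LFunctions.NumberField`,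
helpers under `ClassMeanSquare`), continuing `ClassGroupLFunctionFunctionalEquation.lean`
(`Z_a(s) = Σ_C a(C) ζ(C, s)`, functional equation `Λ_a(1 − s) = Λ_{a∘σ⁻¹}(s)`) and
`ClassGroupLFunctionConvexity.lean` (uniform convexity bound for `Z₁_a = (s − 1) Z_a`).
Everything in this file is PROVED (two definitions with bodies — the Dirichlet coefficients
`classNormCount`, `classCoeff` — and theorems; no named facts).

## Main results

Let `K` be an imaginary quadratic field (`[K:ℚ] = 2`, `d_K < 0`), `a : Cl_K → ℂ` with `|a| ≤ 1`.

* `classTwistedZeta_meanSquare_le` — **for `1/2 < σ₁ ≤ σ₂ < 1` there is `C` with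
  `∫_{−T}^{T} |Z_a(σ + it)|² dt ≤ C T` for all `|a| ≤ 1`, `σ ∈ [σ₁, σ₂]`, `T ≥ 1`.**
* `classGroupLFunction_meanSquare_le` — the same for the class group `L`-functions `L(s, χ)`
  (and `ζ_K = L(s, 1)`): the mean-square input of Voronin's joint universality theorem for these
  degree-2 `L`-functions (Karatsuba–Voronin Ch. VII §3; Steuding Thm. 1.10 / §13.8).

This is the classical fact that the mean-square half-plane of a degree-`d` `L`-function with a
Riemann-type functional equation contains `σ > max(1/2, 1 − 1/d)` (Potter 1940; Carlson;
Chandrasekharan–Narasimhan; [Steuding2007, Cor. 6.11]: "Let `𝓛 ∈ 𝒮`. For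
`σ > max{1/2, 1 − 1/d_𝓛}`, `lim (1/2T)∫_{−T}^{T}|𝓛(σ+it)|²dt = Σ |a(n)|²/n^{2σ}`"), here `d = 2`,
in the weaker form `≪ T` (which is what universality consumes) and for the whole linear family
`Z_a`, `|a| ≤ 1`, which is closed under the functional equation.

## The proof (a `σ`-iteration; not the printed route through the approximate functional equation)

For `1/2 < σ < 1`, `X ≥ 1` and a shift `0 < a' < 1` put `σ' = σ − a'`. The Cahen–Mellin integral
and the residue theorem give (`smoothedSum_eq`)

  `Σ_n c_a(n) n^{−s} e^{−n/X} = Z_a(s) + Z₁_a(1)Γ(1−s)X^{1−s} + (1/2πi)∫_{(−a')} Z_a(s+w)Γ(w)X^w dw`,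

with `c_a(n) = Σ_C a(C) r_C(n)`, `r_C(n) = #{𝔞 ∈ C : N𝔞 = n} ≤ c_K(n) ≪ n^ε`
(`classTwistedZeta_eq_LSeries`, `exists_idealNormCount_le_rpow`). On `|t| ≤ T`:
the smoothed sum has mean square `≪ T + X^{2−2σ+2ε}` (Montgomery–Vaughan,
`meanSquare_smoothedSum_le`); the `Γ`-term has mean square `≪ X^{2−2σ}`; and by Cauchy–Schwarz with
the weight `|Γ(−a'+iy)|` and Fubini, the shifted integral has mean square
`≪ X^{−2a'} · sup_{|y|} ∫_{−T−|y|}^{T+|y|} |Z_a(σ'+iu)|²du` (`meanSquare_remainder_le`), which the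
functional equation in modulus (`exists_norm_classTwistedZeta_le_of_discr_neg`: on `Re s = σ'`,
`|Z_b(s)| ≤ C(1+|t|)^{1−2σ'}|Z_{b∘σ}(1−s)|`, Stirling-order bounds for `Γ`) converts into
`≪ X^{−2a'} T^{3−4σ'} · (mean square on the dual line 1 − σ')` (`meanSquare_transfer`). With
`X = T^λ`, `λ = (1−2σ')/(σ₁−σ')`, all three are `≪ T` as soon as `(1−2σ')(2−2σ₁) < σ₁ − σ'`
(`meanSquare_step`). Starting from the half-plane `σ'' > 1` and choosing the dual line just inside
the region already treated, the admissible `σ₁` improves along `τ ↦ (3τ−1)/(4τ−1)`, i.e.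
`τ_k = (k+1)/(2k+1) ↓ 1/2` (`meanSquare_of_lines`, `meanSquare_lines`), which exhausts `σ > 1/2`.
(For degree `d` the same iteration converges to `max(1/2, 1 − 1/d)`.)

Auxiliary results of independent use: `classSumCont_eq_LSeries` (`ζ(C,s) = Σ r_C(n)n^{−s}`),
`idealNormCount_le_card_divisors_pow` (`c_K(n) ≤ d(n)^{[K:ℚ]}`), Stirling-order bounds
`ClassMeanSquare.exists_norm_Gamma_le_strip` (`|Γ(x+iu)| ≪ (1+|u|)^{x−1/2}e^{−π|u|/2}`,
`1/2 ≤ x ≤ 3/2`), `ClassMeanSquare.exists_norm_Gamma_one_sub_le` (`|Γ(1−s)/Γ(s)| ≪ (1+|t|)^{1−2σ}`),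
`ClassMeanSquare.norm_Gamma_neg_line_le`, `ClassMeanSquare.tsum_rpow_mul_exp_neg_le`
(`Σ n^α e^{−n/Y} ≤ 1 + Γ(α+1)Y^{α+1}`), `ClassMeanSquare.integral_mul_sq_le` (weighted
Cauchy–Schwarz).

## References

* [Steuding2007] J. Steuding, *Value-Distribution of L-Functions*, LNM 1877, Springer 2007:
  Thm. 2.4 (Carlson's mean-square theorem), Cor. 6.11 (mean-square half-plane
  `σ > max(1/2, 1 − 1/d_𝓛)`; PDF p. 111 of the held copy), §1.4 Thm. 1.10.
* [Titchmarsh1986] E. C. Titchmarsh, *The Theory of the Riemann Zeta-Function*, 2nd ed. (1986),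
  §2.7, §2.15 (Cahen–Mellin and the shift of the line), §7.9 (mean-value theorems in the strip),
  §4.12 (Stirling-order bounds for `Γ`).
* [MontgomeryVaughan1974] H. L. Montgomery, R. C. Vaughan, *Hilbert's inequality*, J. London
  Math. Soc. (2) 8 (1974), Corollary 3 (the tree's `DirichletMVT.meanSquare_tsum_shift_le`).
* [NeukirchANT1999] J. Neukirch, *Algebraic Number Theory*, Springer 1999, Ch. VII (5.2),
  (5.9)–(5.11), (8.6).
* [Rademacher1959] H. Rademacher, *On the Phragmén–Lindelöf theorem and some applications*,
  Math. Z. 72 (1959), Thm. 4 (the convexity bound used through `norm_classTwistedZeta₁_le`).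
-/

noncomputable section

open scoped NumberField nonZeroDivisors
open NumberField NumberField.InfinitePlace Complex Filter Topology Set MeasureTheory
open scoped Real

namespace Literature.NumberTheory.LFunctions.NumberField

variable (K : Type*) [Field K] [NumberField K]

/-! ### Dirichlet coefficients of `ζ(C, s)` and of `Z_a(s)` -/

/-- `r_C(n)`: the number of integral ideals of norm `n` in the class `C` (the `n`-th Dirichlet
coefficient of the class partial zeta function `ζ(C, s)`). [cite: NeukirchANT1999, Ch. VII (5.2)] -/
def classNormCount (C : ClassGroup (𝓞 K)) (n : ℕ) : ℕ :=
  Nat.card ((fun J : {I : (Ideal (𝓞 K))⁰ // ClassGroup.mk0 I = C} ↦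
    Ideal.absNorm (J.1 : Ideal (𝓞 K))) ⁻¹' {n})

/-- The Dirichlet coefficients `c_a(n) = Σ_C a(C) r_C(n)` of `Z_a(s) = Σ_C a(C) ζ(C, s)`.
[cite: NeukirchANT1999, Ch. VII (5.2)] -/
def classCoeff (a : ClassGroup (𝓞 K) → ℂ) (n : ℕ) : ℂ :=
  ∑ C : ClassGroup (𝓞 K), a C * (classNormCount K C n : ℂ)

variable {K}

/-- `Σ_C r_C(n) ≤ c_K(n)` (the classes of the nonzero ideals of norm `n` inject into the ideals of
norm `n`). [folklore] -/
theorem sum_classNormCount_le (n : ℕ) :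
    ∑ C : ClassGroup (𝓞 K), classNormCount K C n ≤ idealNormCount K n := by
  classical
  haveI hfin : Finite {I : Ideal (𝓞 K) // Ideal.absNorm I = n} :=
    (Ideal.finite_setOf_absNorm_eq n).to_subtype
  -- the sigma type of the fibres injects into the ideals of norm `n`
  set F : ClassGroup (𝓞 K) → Type _ := fun C ↦
    ((fun J : {I : (Ideal (𝓞 K))⁰ // ClassGroup.mk0 I = C} ↦ Ideal.absNorm (J.1 : Ideal (𝓞 K))) ⁻¹' {n})
    with hF
  set f : (Σ C, F C) → {I : Ideal (𝓞 K) // Ideal.absNorm I = n} :=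
    fun x ↦ ⟨(x.2.1.1 : Ideal (𝓞 K)), by
      have h := x.2.2; simp only [Set.mem_preimage, Set.mem_singleton_iff] at h; exact h⟩
    with hf
  have hinj : Function.Injective f := by
    rintro ⟨C, ⟨⟨I, hI⟩, hIn⟩⟩ ⟨C', ⟨⟨I', hI'⟩, hIn'⟩⟩ h
    simp only [hf, Subtype.mk.injEq] at h
    have hII' : I = I' := Subtype.ext h
    subst hII'
    have hCC' : C = C' := by rw [← hI, ← hI']
    subst hCC'
    rfl
  haveI : ∀ C, Finite (F C) := fun C ↦ by
    refine Finite.of_injective (fun x : F C ↦ f ⟨C, x⟩) ?_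
    intro x y hxy
    have := hinj hxy
    simp only [Sigma.mk.injEq, heq_eq_eq, true_and] at this
    exact this
  haveI : Finite (Σ C, F C) := Finite.instSigma
  have h1 : Nat.card (Σ C, F C) ≤ Nat.card {I : Ideal (𝓞 K) // Ideal.absNorm I = n} :=
    Nat.card_le_card_of_injective f hinj
  rw [Nat.card_sigma] at h1
  simpa [classNormCount, idealNormCount, hF] using h1

/-- `r_C(n) ≤ c_K(n)`. [folklore] -/
theorem classNormCount_le (C : ClassGroup (𝓞 K)) (n : ℕ) :
    classNormCount K C n ≤ idealNormCount K n :=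
  le_trans (Finset.single_le_sum (f := fun C ↦ classNormCount K C n) (fun _ _ ↦ Nat.zero_le _)
    (Finset.mem_univ C)) (sum_classNormCount_le n)

/-- `r_C(0) = 0` (nonzero ideals have nonzero norm). [folklore] -/
theorem classNormCount_zero (C : ClassGroup (𝓞 K)) : classNormCount K C 0 = 0 := by
  rw [classNormCount, Nat.card_eq_zero]
  left
  refine ⟨fun ⟨J, hJ⟩ ↦ ?_⟩
  simp only [Set.mem_preimage, Set.mem_singleton_iff, Ideal.absNorm_eq_zero_iff] at hJ
  exact (mem_nonZeroDivisors_iff_ne_zero.mp J.1.2) hJ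

/-- `c_a(0) = 0`. [folklore] -/
theorem classCoeff_zero (a : ClassGroup (𝓞 K) → ℂ) : classCoeff K a 0 = 0 := by
  simp [classCoeff, classNormCount_zero]

/-- `|c_a(n)| ≤ c_K(n)` for `|a| ≤ 1`. [folklore] -/
theorem norm_classCoeff_le {a : ClassGroup (𝓞 K) → ℂ} (ha : ∀ C, ‖a C‖ ≤ 1) (n : ℕ) :
    ‖classCoeff K a n‖ ≤ idealNormCount K n := by
  calc ‖classCoeff K a n‖ ≤ ∑ C, ‖a C * (classNormCount K C n : ℂ)‖ := norm_sum_le _ _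
    _ ≤ ∑ C, (classNormCount K C n : ℝ) := Finset.sum_le_sum fun C _ ↦ by
        rw [norm_mul, Complex.norm_natCast]
        exact mul_le_of_le_one_left (Nat.cast_nonneg _) (ha C)
    _ ≤ idealNormCount K n := by exact_mod_cast sum_classNormCount_le n

/-- `c_K(n) ≤ d(n)^{[K:ℚ]}` for `n ≥ 1` (`c_K` is multiplicative, `c_K(p^e) ≤ (e+1)^{[K:ℚ]}`).
[folklore] -/
theorem idealNormCount_le_card_divisors_pow {n : ℕ} (hn : n ≠ 0) :
    idealNormCount K n ≤ n.divisors.card ^ Module.finrank ℚ K := by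
  induction n using Nat.recOnPosPrimePosCoprime with
  | prime_pow p e hp he =>
    calc idealNormCount K (p ^ e) ≤ (e + 1) ^ Module.finrank ℚ K :=
          IdealNormCount.idealNormCount_prime_pow_le_nat K hp e
      _ = (p ^ e).divisors.card ^ Module.finrank ℚ K := by
          rw [← ArithmeticFunction.sigma_zero_apply,
            ArithmeticFunction.sigma_zero_apply_prime_pow hp]
  | zero => exact absurd rfl hn
  | one => simp [idealNormCount_one]
  | coprime m k hm hk hmk ihm ihk =>
    rw [idealNormCount_mul_of_coprime K hmk, Nat.Coprime.card_divisors_mul hmk, mul_pow]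
    exact Nat.mul_le_mul (ihm (by omega)) (ihk (by omega))

/-- **`c_K(n) ≪_ε n^ε`**: for every `ε > 0` there is `C ≥ 1` with `c_K(n) ≤ C n^ε` for `n ≥ 1`
(divisor bound, Hardy–Wright Thm 315). [folklore] -/
theorem exists_idealNormCount_le_rpow {ε : ℝ} (hε : 0 < ε) :
    ∃ C : ℝ, 1 ≤ C ∧ ∀ n : ℕ, n ≠ 0 → (idealNormCount K n : ℝ) ≤ C * (n : ℝ) ^ ε := by
  set d : ℕ := Module.finrank ℚ K with hd
  have hd0 : 0 < d := Module.finrank_pos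
  obtain ⟨C, hC1, hC⟩ :=
    Literature.NumberTheory.Sieve.exists_card_divisors_le_mul_rpow (ε := ε / d) (by positivity)
  refine ⟨C ^ d, one_le_pow₀ hC1, fun n hn ↦ ?_⟩
  have h1 : (idealNormCount K n : ℝ) ≤ ((n.divisors.card : ℝ)) ^ d := by
    exact_mod_cast idealNormCount_le_card_divisors_pow hn
  have h2 : ((n.divisors.card : ℝ)) ^ d ≤ (C * (n : ℝ) ^ (ε / d)) ^ d :=
    pow_le_pow_left₀ (Nat.cast_nonneg _) (hC n hn) d
  have h3 : (C * (n : ℝ) ^ (ε / d)) ^ d = C ^ d * (n : ℝ) ^ ε := by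
    rw [mul_pow, ← Real.rpow_natCast ((n : ℝ) ^ (ε / d)) d, ← Real.rpow_mul (Nat.cast_nonneg _)]
    congr 2
    field_simp
  linarith [h3 ▸ h2]

/-- **`ζ(C, z) = Σ_n r_C(n) n^{-z}`** for `Re z > 1`. [cite: NeukirchANT1999, Ch. VII (5.2), (5.9)] -/
theorem classSumCont_eq_LSeries (C : ClassGroup (𝓞 K)) {z : ℂ} (hz : 1 < z.re) :
    classSumCont (thetaIdeal_inv_holds K) C z = LSeries (fun n ↦ (classNormCount K C n : ℂ)) z := by
  classical
  rw [classSumCont_eq_tsum _ C hz]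
  set f : {I : (Ideal (𝓞 K))⁰ // ClassGroup.mk0 I = C} → ℂ :=
    fun J ↦ ((Ideal.absNorm (J.1 : Ideal (𝓞 K)) : ℕ) : ℂ) ^ (-z) with hf
  have hsum : Summable f := by
    have h := (Literature.NumberTheory.LFunctions.summable_norm_absNorm_cpow K hz).of_norm
    exact (h.comp_injective Subtype.val_injective).comp_injective Subtype.val_injective
  set g : {I : (Ideal (𝓞 K))⁰ // ClassGroup.mk0 I = C} → ℕ :=
    fun J ↦ Ideal.absNorm (J.1 : Ideal (𝓞 K)) with hg
  have hfib := hsum.hasSum.tsum_fiberwise g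
  rw [← hfib.tsum_eq, LSeries]
  refine tsum_congr fun n ↦ ?_
  rcases eq_or_ne n 0 with rfl | hn
  · haveI : IsEmpty (g ⁻¹' {0}) := ⟨fun ⟨J, hJ⟩ ↦ by
      simp only [Set.mem_preimage, Set.mem_singleton_iff, hg, Ideal.absNorm_eq_zero_iff] at hJ
      exact (mem_nonZeroDivisors_iff_ne_zero.mp J.1.2) hJ⟩
    rw [tsum_empty, LSeries.term_zero]
  haveI hfin : Finite {I : Ideal (𝓞 K) // Ideal.absNorm I = n} :=
    (Ideal.finite_setOf_absNorm_eq n).to_subtype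
  have hinj : Function.Injective (fun x : g ⁻¹' {n} ↦
      (⟨(x.1.1 : Ideal (𝓞 K)), by
        have h := x.2
        simp only [Set.mem_preimage, Set.mem_singleton_iff, hg] at h
        exact h⟩ : {I : Ideal (𝓞 K) // Ideal.absNorm I = n})) := by
    rintro ⟨⟨I, hI⟩, hIn⟩ ⟨⟨I', hI'⟩, hIn'⟩ h
    simp only [Subtype.mk.injEq] at h
    have hII' : I = I' := Subtype.ext h
    subst hII'
    rfl
  haveI : Finite (g ⁻¹' {n}) := Finite.of_injective _ hinj
  have hconst : ∀ J : g ⁻¹' {n}, f J = ((n : ℕ) : ℂ) ^ (-z) := by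
    rintro ⟨J, hJ⟩
    simp only [Set.mem_preimage, Set.mem_singleton_iff, hg] at hJ
    simp only [hf, hJ]
  rw [tsum_congr hconst, tsum_const, nsmul_eq_mul, LSeries.term_of_ne_zero hn, Complex.cpow_neg,
    div_eq_mul_inv]
  rfl

/-- The Dirichlet series of `r_C` converges absolutely for `Re z > 1`. [folklore] -/
theorem LSeriesSummable_classNormCount (C : ClassGroup (𝓞 K)) {z : ℂ} (hz : 1 < z.re) :
    LSeriesSummable (fun n ↦ (classNormCount K C n : ℂ)) z := by
  refine Summable.of_norm_bounded (LSeriesSummable_idealNormCount K hz).norm (fun n ↦ ?_)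
  rcases eq_or_ne n 0 with rfl | hn
  · simp
  · simp only [LSeries.term_of_ne_zero hn, norm_div, Complex.norm_natCast]
    gcongr
    exact_mod_cast classNormCount_le C n

/-- The Dirichlet series of `c_a` converges absolutely for `Re z > 1` (`|a| ≤ 1`). [folklore] -/
theorem LSeriesSummable_classCoeff {a : ClassGroup (𝓞 K) → ℂ} (ha : ∀ C, ‖a C‖ ≤ 1) {z : ℂ}
    (hz : 1 < z.re) : LSeriesSummable (classCoeff K a) z := by
  refine Summable.of_norm_bounded (LSeriesSummable_idealNormCount K hz).norm (fun n ↦ ?_)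
  rcases eq_or_ne n 0 with rfl | hn
  · simp
  · simp only [LSeries.term_of_ne_zero hn, norm_div, Complex.norm_natCast]
    gcongr
    exact norm_classCoeff_le ha n

/-- **`Z_a(z) = Σ_n c_a(n) n^{-z}`** for `Re z > 1`. [cite: NeukirchANT1999, Ch. VII (5.2), (5.9)] -/
theorem classTwistedZeta_eq_LSeries (a : ClassGroup (𝓞 K) → ℂ) {z : ℂ} (hz : 1 < z.re) :
    classTwistedZeta K a z = LSeries (classCoeff K a) z := by
  have hterm : ∀ n, LSeries.term (classCoeff K a) z n =
      ∑ C, a C * LSeries.term (fun n ↦ (classNormCount K C n : ℂ)) z n := by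
    intro n
    rcases eq_or_ne n 0 with rfl | hn
    · simp
    · simp only [LSeries.term_of_ne_zero hn, classCoeff, Finset.sum_div, mul_div_assoc]
  simp only [classTwistedZeta, LSeries, tsum_congr hterm]
  rw [Summable.tsum_finsetSum (fun C _ ↦ ((LSeriesSummable_classNormCount C hz).mul_left (a C)))]
  refine Finset.sum_congr rfl fun C _ ↦ ?_
  rw [tsum_mul_left, classSumCont_eq_LSeries C hz, LSeries]

/-! ### Stirling-order bounds for `Γ` and the functional equation in modulus -/

namespace ClassMeanSquare

/-- `‖sin w‖ ≤ e^{|Im w|}`. [folklore] -/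
theorem norm_sin_le_exp_abs_im (w : ℂ) : ‖Complex.sin w‖ ≤ Real.exp |w.im| := by
  have h2 : (2 : ℝ) * ‖Complex.sin w‖ = ‖Complex.exp (-w * I) - Complex.exp (w * I)‖ := by
    rw [← Complex.norm_two, ← norm_mul, Complex.two_sin, norm_mul, Complex.norm_I, mul_one]
  have ha : ‖Complex.exp (w * I)‖ ≤ Real.exp |w.im| := by
    rw [Complex.norm_exp]
    exact Real.exp_monotone (by simp [neg_le_abs])
  have hb : ‖Complex.exp (-w * I)‖ ≤ Real.exp |w.im| := by
    rw [Complex.norm_exp]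
    exact Real.exp_monotone (by simp [le_abs_self])
  linarith [norm_sub_le (Complex.exp (-w * I)) (Complex.exp (w * I))]

/-- `‖Γ(1/2 + iu)‖ ≤ √(2π) e^{−π|u|/2}` (`|Γ(1/2+iu)|² = π/cosh(πu)`). [folklore] -/
theorem norm_Gamma_half_le (u : ℝ) :
    ‖Complex.Gamma (1 / 2 + u * I)‖ ≤ Real.sqrt (2 * π) * Real.exp (-(π * |u|) / 2) := by
  have hsq := Literature.Analysis.SpecialFunctions.GammaVert.norm_sq_Gamma_half u
  have hcosh : Real.exp (π * |u|) / 2 ≤ Real.cosh (π * u) := by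
    rw [Real.cosh_eq]
    rcases le_or_gt 0 u with hu | hu
    · rw [abs_of_nonneg hu]; linarith [Real.exp_pos (-(π * u))]
    · rw [abs_of_neg hu, show π * -u = -(π * u) by ring]; linarith [Real.exp_pos (π * u)]
  have hpos : 0 < Real.cosh (π * u) := Real.cosh_pos _
  have hb : ‖Complex.Gamma (1 / 2 + u * I)‖ ^ 2 ≤
      (Real.sqrt (2 * π) * Real.exp (-(π * |u|) / 2)) ^ 2 := by
    rw [hsq, mul_pow, Real.sq_sqrt (by positivity), ← Real.exp_nat_mul]
    rw [show ((2 : ℕ) : ℝ) * (-(π * |u|) / 2) = -(π * |u|) by push_cast; ring, Real.exp_neg,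
      div_le_iff₀ hpos]
    have hE := Real.exp_pos (π * |u|)
    calc π = 2 * π * (Real.exp (π * |u|))⁻¹ * (Real.exp (π * |u|) / 2) := by
          field_simp
      _ ≤ 2 * π * (Real.exp (π * |u|))⁻¹ * Real.cosh (π * u) := by gcongr
  exact (pow_le_pow_iff_left₀ (norm_nonneg _) (by positivity) two_ne_zero).mp hb

/-- **Stirling-order upper bound on `1/2 ≤ Re ≤ 3/2`**: there is `C_Γ > 0` with
`‖Γ(x + iu)‖ ≤ C_Γ (1 + |u|)^{x − 1/2} e^{−π|u|/2}` for `1/2 ≤ x ≤ 3/2` and all real `u` (the tree's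
vertical ratio bound `GammaRatio.exists_norm_Gamma_shift_le` from the line `Re = 1/2`, where
`|Γ|² = π/cosh`). [cite: Titchmarsh1986, §4.12 (4.12.3), consequence] -/
theorem exists_norm_Gamma_le_strip :
    ∃ Cg : ℝ, 0 < Cg ∧ ∀ x u : ℝ, 1 / 2 ≤ x → x ≤ 3 / 2 →
      ‖Complex.Gamma (x + u * I)‖ ≤ Cg * (1 + |u|) ^ (x - 1 / 2) * Real.exp (-(π * |u|) / 2) := by
  obtain ⟨K₀, hK₀, hK⟩ :=
    Literature.Analysis.SpecialFunctions.GammaRatio.exists_norm_Gamma_shift_le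
      (x₀ := 1 / 2) one_half_pos
  refine ⟨K₀ * Real.sqrt (2 * π), by positivity, fun x u hx1 hx2 ↦ ?_⟩
  have h := hK (1 / 2) (x - 1 / 2) u le_rfl (by norm_num) (by linarith) (by linarith)
  have hcast : (((1 / 2 + (x - 1 / 2) : ℝ)) : ℂ) = (x : ℂ) := by congr 1; ring
  rw [hcast] at h
  have hhalf : ‖Complex.Gamma (((1 / 2 : ℝ) : ℂ) + u * I)‖ ≤
      Real.sqrt (2 * π) * Real.exp (-(π * |u|) / 2) := by
    have := norm_Gamma_half_le u
    convert this using 3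
    push_cast; ring
  calc ‖Complex.Gamma (x + u * I)‖ ≤ K₀ * (1 + |u|) ^ (x - 1 / 2) *
        ‖Complex.Gamma (((1 / 2 : ℝ) : ℂ) + u * I)‖ := h
    _ ≤ K₀ * (1 + |u|) ^ (x - 1 / 2) * (Real.sqrt (2 * π) * Real.exp (-(π * |u|) / 2)) := by
        gcongr
    _ = K₀ * Real.sqrt (2 * π) * (1 + |u|) ^ (x - 1 / 2) * Real.exp (-(π * |u|) / 2) := by ring

/-- `σ' + iu ∉ ℤ` when `σ'` is not an integer. [folklore] -/
theorem ne_int_of_re_ne_int {σ' u : ℝ} (h : ∀ n : ℤ, σ' ≠ n) (n : ℤ) : (σ' : ℂ) + u * I ≠ n := by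
  intro he
  have := congrArg Complex.re he
  simp at this
  exact h n this

/-- **The reflection quotient**: there is `C₀ > 0` such that for `−1/2 ≤ σ' ≤ 1/2` and
`s = σ' + iu ∉ ℤ`, `‖Γ(1 − s)‖ ≤ C₀ (1 + |u|)^{1 − 2σ'} ‖Γ(s)‖` (reflection formula
`Γ(s)Γ(1−s) = π/sin πs`, `|sin πs| ≤ e^{π|u|}`, and the Stirling-order bound for `Γ(1 − s)`).
[cite: Titchmarsh1986, §4.12 (4.12.3), consequence] -/
theorem exists_norm_Gamma_one_sub_le :
    ∃ C₀ : ℝ, 0 < C₀ ∧ ∀ σ' u : ℝ, -1 / 2 ≤ σ' → σ' ≤ 1 / 2 → (∀ n : ℤ, (σ' : ℂ) + u * I ≠ n) →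
      ‖Complex.Gamma (1 - (σ' + u * I))‖ ≤
        C₀ * (1 + |u|) ^ (1 - 2 * σ') * ‖Complex.Gamma (σ' + u * I)‖ := by
  obtain ⟨Cg, hCg, hG⟩ := exists_norm_Gamma_le_strip
  refine ⟨Cg ^ 2 / π, by positivity, fun σ' u h1 h2 hs ↦ ?_⟩
  set s : ℂ := σ' + u * I with hs_def
  set B : ℝ := (1 + |u|) ^ (1 - 2 * σ') with hB
  have hB0 : 0 < B := Real.rpow_pos_of_pos (by positivity) _
  -- the reflection formula in modulus: `‖Γ s‖ ‖Γ(1-s)‖ = π / ‖sin π s‖ ≥ π e^{-π|u|}`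
  have hrefl := Complex.Gamma_mul_Gamma_one_sub s
  have hsin0 : Complex.sin (π * s) ≠ 0 := by
    rw [Complex.sin_ne_zero_iff]
    intro k hk
    apply hs k
    have hπ : (π : ℂ) ≠ 0 := Complex.ofReal_ne_zero.mpr Real.pi_ne_zero
    have : s = k := by
      have h' : (k : ℂ) * π = s * π := by rw [← hk]; ring
      exact (mul_right_cancel₀ hπ h').symm
    rw [hs_def] at this; exact this
  have hsin_le : ‖Complex.sin (π * s)‖ ≤ Real.exp (π * |u|) := by
    refine (norm_sin_le_exp_abs_im _).trans (le_of_eq ?_)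
    congr 1
    rw [hs_def]; simp [abs_mul, abs_of_pos Real.pi_pos]
  have hprod : ‖Complex.Gamma s‖ * ‖Complex.Gamma (1 - s)‖ = π / ‖Complex.sin (π * s)‖ := by
    rw [← norm_mul, hrefl, norm_div, Complex.norm_real, Real.norm_eq_abs, abs_of_pos Real.pi_pos]
  have hsinpos : 0 < ‖Complex.sin (π * s)‖ := norm_pos_iff.mpr hsin0
  have hprod_ge : π * Real.exp (-(π * |u|)) ≤ ‖Complex.Gamma s‖ * ‖Complex.Gamma (1 - s)‖ := by
    rw [hprod, Real.exp_neg, le_div_iff₀ hsinpos]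
    calc π * (Real.exp (π * |u|))⁻¹ * ‖Complex.sin (π * s)‖
        ≤ π * (Real.exp (π * |u|))⁻¹ * Real.exp (π * |u|) := by gcongr
      _ = π := by field_simp
  -- Stirling for `Γ(1 - s) = Γ((1-σ') + (-u) i)`
  have h1s : (1 : ℂ) - s = ((1 - σ' : ℝ) : ℂ) + ((-u : ℝ) : ℂ) * I := by
    rw [hs_def]; push_cast; ring
  have hG1 : ‖Complex.Gamma (1 - s)‖ ≤ Cg * (1 + |u|) ^ (1 / 2 - σ') * Real.exp (-(π * |u|) / 2) := by
    have := hG (1 - σ') (-u) (by linarith) (by linarith)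
    rw [← h1s, abs_neg] at this
    convert this using 3
    ring
  -- `‖Γ(1-s)‖² ≤ Cg² B e^{-π|u|} ≤ (Cg²/π) B ‖Γ s‖ ‖Γ(1-s)‖`
  have hsq : ‖Complex.Gamma (1 - s)‖ ^ 2 ≤ Cg ^ 2 * B * Real.exp (-(π * |u|)) := by
    have h0 : 0 ≤ Cg * (1 + |u|) ^ (1 / 2 - σ') * Real.exp (-(π * |u|) / 2) := by positivity
    calc ‖Complex.Gamma (1 - s)‖ ^ 2
        ≤ (Cg * (1 + |u|) ^ (1 / 2 - σ') * Real.exp (-(π * |u|) / 2)) ^ 2 :=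
          pow_le_pow_left₀ (norm_nonneg _) hG1 2
      _ = Cg ^ 2 * B * Real.exp (-(π * |u|)) := by
          rw [mul_pow, mul_pow, ← Real.exp_nat_mul, ← Real.rpow_natCast ((1 + |u|) ^ _) 2,
            ← Real.rpow_mul (by positivity), hB]
          congr 2
          · norm_num; ring
          · push_cast; ring
  have hkey : ‖Complex.Gamma (1 - s)‖ ^ 2 ≤
      Cg ^ 2 / π * B * ‖Complex.Gamma s‖ * ‖Complex.Gamma (1 - s)‖ := by
    calc ‖Complex.Gamma (1 - s)‖ ^ 2 ≤ Cg ^ 2 * B * Real.exp (-(π * |u|)) := hsq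
      _ = Cg ^ 2 / π * B * (π * Real.exp (-(π * |u|))) := by field_simp
      _ ≤ Cg ^ 2 / π * B * (‖Complex.Gamma s‖ * ‖Complex.Gamma (1 - s)‖) := by gcongr
      _ = _ := by ring
  have hG1pos : 0 < ‖Complex.Gamma (1 - s)‖ := by
    rcases (norm_nonneg (Complex.Gamma (1 - s))).eq_or_lt with h0 | h0
    · exfalso
      rw [← h0, mul_zero] at hprod_ge
      linarith [mul_pos Real.pi_pos (Real.exp_pos (-(π * |u|)))]
    · exact h0
  rw [sq] at hkey
  exact le_of_mul_le_mul_right (by linarith [hkey]) hG1pos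

end ClassMeanSquare

/-! ### The gamma factor of an imaginary quadratic field and the functional equation in modulus -/

/-- An imaginary quadratic field (`[K:ℚ] = 2`, `d_K < 0`) has `r₁ = 0`, `r₂ = 1`. [folklore] -/
theorem nrRealPlaces_eq_zero_and_nrComplexPlaces_eq_one_of_discr_neg
    (h2 : Module.finrank ℚ K = 2) (hd : NumberField.discr K < 0) :
    nrRealPlaces K = 0 ∧ nrComplexPlaces K = 1 := by
  have hsign := NumberField.sign_discr K
  rw [Int.sign_eq_neg_one_of_neg hd] at hsign
  have hodd : Odd (nrComplexPlaces K) := by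
    by_contra h
    rw [Nat.not_odd_iff_even] at h
    rw [h.neg_one_pow] at hsign
    norm_num at hsign
  have hrk := card_add_two_mul_card_eq_rank K
  rw [h2] at hrk
  obtain ⟨m, hm⟩ := hodd
  constructor <;> omega

/-- For an imaginary quadratic field the gamma factor of `ζ_K` is `|d_K|^{z/2} Γ_ℂ(z)`.
[cite: NeukirchANT1999, Ch. VII (5.10)] -/
theorem dedekindGammaFactor_eq_of_discr_neg (h2 : Module.finrank ℚ K = 2)
    (hd : NumberField.discr K < 0) (z : ℂ) :
    dedekindGammaFactor K z = ((NumberField.discr K).natAbs : ℂ) ^ (z / 2) * Gammaℂ z := by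
  obtain ⟨h0, h1⟩ := nrRealPlaces_eq_zero_and_nrComplexPlaces_eq_one_of_discr_neg h2 hd
  rw [dedekindGammaFactor, h0, h1, pow_zero, mul_one, pow_one]

/-- **The functional equation of `Z_a` in modulus, imaginary quadratic case.** There are a
permutation `σ` of `Cl_K` and `C₁ > 0` such that for every `b : Cl_K → ℂ`, every
`−1/2 ≤ σ' ≤ 1/2` and every `s = σ' + iu ∉ ℤ`:
`‖Z_b(s)‖ ≤ C₁ (1 + |u|)^{1 − 2σ'} ‖Z_{b∘σ}(1 − s)‖`
(from `Λ_{b∘σ}(1 − s) = Λ_b(s)`, `Λ_b = |d_K|^{s/2} Γ_ℂ(s) Z_b`, and the reflection quotient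
`‖Γ(1−s)/Γ(s)‖ ≪ (1+|u|)^{1−2σ'}`). [cite: NeukirchANT1999, Ch. VII (8.6)] -/
theorem exists_norm_classTwistedZeta_le_of_discr_neg (h2 : Module.finrank ℚ K = 2)
    (hd : NumberField.discr K < 0) :
    ∃ σp : ClassGroup (𝓞 K) ≃ ClassGroup (𝓞 K), ∃ C₁ : ℝ, 0 < C₁ ∧
      ∀ (b : ClassGroup (𝓞 K) → ℂ) (σ' u : ℝ), -1 / 2 ≤ σ' → σ' ≤ 1 / 2 →
        (∀ n : ℤ, (σ' : ℂ) + u * I ≠ n) →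
        ‖classTwistedZeta K b (σ' + u * I)‖ ≤
          C₁ * (1 + |u|) ^ (1 - 2 * σ') * ‖classTwistedZeta K (b ∘ σp) (1 - (σ' + u * I))‖ := by
  obtain ⟨σp, hσp⟩ := exists_perm_completedClassTwistedZeta_one_sub (K := K)
  obtain ⟨C₀, hC₀, hΓ⟩ := ClassMeanSquare.exists_norm_Gamma_one_sub_le
  set d : ℝ := ((NumberField.discr K).natAbs : ℝ) with hd_def
  have hd1 : 1 ≤ d := by
    rw [hd_def]; exact_mod_cast Int.natAbs_pos.mpr (NumberField.discr_ne_zero K)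
  have hd0 : 0 < d := by linarith
  refine ⟨σp, d * C₀, by positivity, fun b σ' u h1 h2' hs ↦ ?_⟩
  set s : ℂ := σ' + u * I with hs_def
  have hsre : s.re = σ' := by simp [hs_def]
  -- the functional equation `γ(s) Z_b(s) = γ(1-s) Z_{b∘σ}(1-s)`
  have hFE := hσp (b ∘ σp) (s := s) hs
  have hbb : (b ∘ σp) ∘ σp.symm = b := by funext C; simp
  rw [hbb] at hFE
  simp only [completedClassTwistedZeta, dedekindGammaFactor_eq_of_discr_neg h2 hd] at hFE
  -- norms of the gamma factors
  have hdC : ((NumberField.discr K).natAbs : ℂ) = ((d : ℝ) : ℂ) := by rw [hd_def]; push_cast; rfl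
  have hnd : ∀ w : ℂ, ‖((NumberField.discr K).natAbs : ℂ) ^ w‖ = d ^ w.re := fun w ↦ by
    rw [hdC, Complex.norm_cpow_eq_rpow_re_of_pos hd0]
  have h2π : (0 : ℝ) < 2 * π := by positivity
  have hn2π : ∀ w : ℂ, ‖(2 * π : ℂ) ^ w‖ = (2 * π) ^ w.re := fun w ↦ by
    rw [show (2 * π : ℂ) = ((2 * π : ℝ) : ℂ) by push_cast; ring,
      Complex.norm_cpow_eq_rpow_re_of_pos h2π]
  have hγ : ∀ w : ℂ, ‖((NumberField.discr K).natAbs : ℂ) ^ (w / 2) * Gammaℂ w‖ =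
      d ^ (w.re / 2) * (2 * (2 * π) ^ (-w.re)) * ‖Complex.Gamma w‖ := by
    intro w
    rw [norm_mul, Gammaℂ_def, norm_mul, norm_mul, hnd, hn2π, Complex.norm_two]
    simp only [Complex.neg_re, Complex.div_ofNat_re]
    ring
  have hL : ‖((NumberField.discr K).natAbs : ℂ) ^ ((1 - s) / 2) * Gammaℂ (1 - s)‖ *
      ‖classTwistedZeta K (b ∘ σp) (1 - s)‖ =
      ‖((NumberField.discr K).natAbs : ℂ) ^ (s / 2) * Gammaℂ s‖ * ‖classTwistedZeta K b s‖ := by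
    rw [← norm_mul, ← norm_mul, hFE]
  rw [hγ, hγ] at hL
  simp only [Complex.sub_re, Complex.one_re, hsre] at hL
  -- positivity of the factor at `s`
  have hΓs : Complex.Gamma s ≠ 0 := by
    apply Complex.Gamma_ne_zero
    intro m hm
    exact hs (-m) (by rw [hs_def] at hm ⊢; exact_mod_cast hm)
  have hΓs_pos : 0 < ‖Complex.Gamma s‖ := norm_pos_iff.mpr hΓs
  have hA : 0 < d ^ (σ' / 2) * (2 * (2 * π) ^ (-σ')) := by positivity
  -- the quotient of the scalar factors is `≤ d`
  have hquot : d ^ ((1 - σ') / 2) * (2 * (2 * π) ^ (-(1 - σ'))) ≤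
      d * (d ^ (σ' / 2) * (2 * (2 * π) ^ (-σ'))) := by
    have e1 : d ^ ((1 - σ') / 2) = d ^ (1 / 2 - σ') * d ^ (σ' / 2) := by
      rw [← Real.rpow_add hd0]; congr 1; ring
    have e2 : (2 * π) ^ (-(1 - σ')) = (2 * π) ^ (2 * σ' - 1) * (2 * π) ^ (-σ') := by
      rw [← Real.rpow_add h2π]; congr 1; ring
    have i1 : d ^ (1 / 2 - σ') ≤ d := by
      conv_rhs => rw [← Real.rpow_one d]
      exact Real.rpow_le_rpow_of_exponent_le hd1 (by linarith)
    have i2 : (2 * π) ^ (2 * σ' - 1) ≤ 1 :=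
      Real.rpow_le_one_of_one_le_of_nonpos (by linarith [Real.pi_gt_three]) (by linarith)
    rw [e1, e2]
    calc d ^ (1 / 2 - σ') * d ^ (σ' / 2) * (2 * ((2 * π) ^ (2 * σ' - 1) * (2 * π) ^ (-σ')))
        ≤ d * d ^ (σ' / 2) * (2 * (1 * (2 * π) ^ (-σ'))) := by gcongr
      _ = d * (d ^ (σ' / 2) * (2 * (2 * π) ^ (-σ'))) := by ring
  -- assemble
  have hΓ1 := hΓ σ' u h1 h2' hs
  rw [← hs_def] at hΓ1
  set Z := ‖classTwistedZeta K b s‖ with hZ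
  set Z' := ‖classTwistedZeta K (b ∘ σp) (1 - s)‖ with hZ'
  set B : ℝ := (1 + |u|) ^ (1 - 2 * σ') with hB
  have hZ'0 : 0 ≤ Z' := norm_nonneg _
  -- from `A(s) ‖Γ s‖ Z = A(1-s) ‖Γ(1-s)‖ Z'` and the two inequalities
  have hmain : d ^ (σ' / 2) * (2 * (2 * π) ^ (-σ')) * ‖Complex.Gamma s‖ * Z ≤
      d ^ (σ' / 2) * (2 * (2 * π) ^ (-σ')) * ‖Complex.Gamma s‖ * (d * C₀ * B * Z') := by
    rw [← hL]
    calc d ^ ((1 - σ') / 2) * (2 * (2 * π) ^ (-(1 - σ'))) * ‖Complex.Gamma (1 - s)‖ * Z'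
        ≤ d * (d ^ (σ' / 2) * (2 * (2 * π) ^ (-σ'))) * (C₀ * B * ‖Complex.Gamma s‖) * Z' := by
          gcongr
      _ = _ := by ring
  have hpos : 0 < d ^ (σ' / 2) * (2 * (2 * π) ^ (-σ')) * ‖Complex.Gamma s‖ := mul_pos hA hΓs_pos
  have := le_of_mul_le_mul_left hmain hpos
  calc Z ≤ d * C₀ * B * Z' := this
    _ = d * C₀ * (1 + |u|) ^ (1 - 2 * σ') * Z' := by rw [hB]

/-! ### Growth and continuity of `Z_a` on vertical lines -/

/-- `‖Z_a(z)‖ ≤ |d_K| e^{2n_K} ‖z + 5/2‖^{n_K+1} / ‖z − 1‖` for `Re z ≥ −1/2`, `z ≠ 1`, `|a| ≤ 1`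
(the tree's uniform convexity bound `norm_classTwistedZeta₁_le`). [cite: Rademacher1959, Thm. 4] -/
theorem norm_classTwistedZeta_le_of_re_ge {a : ClassGroup (𝓞 K) → ℂ} (ha : ∀ C, ‖a C‖ ≤ 1)
    {z : ℂ} (hz : -1 / 2 ≤ z.re) (hz1 : z ≠ 1) :
    ‖classTwistedZeta K a z‖ ≤ ((NumberField.discr K).natAbs : ℝ) *
      Real.exp (2 * Module.finrank ℚ K) * ‖z + 5 / 2‖ ^ (Module.finrank ℚ K + 1) / ‖z - 1‖ := by
  have h := norm_classTwistedZeta₁_le (K := K) ha hz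
  rw [classTwistedZeta₁_apply_of_ne_one a hz1, norm_mul] at h
  have hpos : 0 < ‖z - 1‖ := norm_pos_iff.mpr (sub_ne_zero.mpr hz1)
  rw [le_div_iff₀ hpos, mul_comm]
  exact h

/-- The map `u ↦ Z_a(z₀ + u i)` is continuous whenever `Re z₀ ≠ 1` (the line misses the pole).
[folklore] -/
theorem continuous_classTwistedZeta_vertical (a : ClassGroup (𝓞 K) → ℂ) {z₀ : ℂ} (hz₀ : z₀.re ≠ 1) :
    Continuous fun u : ℝ ↦ classTwistedZeta K a (z₀ + u * I) := by
  have hline : Continuous fun u : ℝ ↦ z₀ + u * I := by fun_prop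
  refine (differentiableOn_classTwistedZeta a).continuousOn.comp_continuous hline fun u h ↦ ?_
  have := congrArg Complex.re (Set.mem_singleton_iff.mp h)
  simp at this
  exact hz₀ this

/-- `Z_a` is differentiable at every `z ≠ 1`. [folklore] -/
theorem differentiableAt_classTwistedZeta (a : ClassGroup (𝓞 K) → ℂ) {z : ℂ} (hz : z ≠ 1) :
    DifferentiableAt ℂ (classTwistedZeta K a) z :=
  (differentiableOn_classTwistedZeta a).differentiableAt (isOpen_compl_singleton.mem_nhds hz)

namespace ClassMeanSquare

/-- `Γ(x) ≤ 1` for `1 ≤ x ≤ 2` (log-convexity of `Γ` between `Γ(1) = Γ(2) = 1`). [folklore] -/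
theorem Real_Gamma_le_one {x : ℝ} (h1 : 1 ≤ x) (h2 : x ≤ 2) : Real.Gamma x ≤ 1 := by
  rcases h1.eq_or_lt with rfl | h1'
  · rw [Real.Gamma_one]
  rcases h2.eq_or_lt with rfl | h2'
  · rw [Real.Gamma_two]
  have h := Real.Gamma_mul_add_mul_le_rpow_Gamma_mul_rpow_Gamma (s := 1) (t := 2) (a := 2 - x)
    (b := x - 1) one_pos two_pos (by linarith) (by linarith) (by ring)
  rw [Real.Gamma_one, Real.Gamma_two, Real.one_rpow, Real.one_rpow, mul_one] at h
  have hx : 2 - x + (x - 1) * 2 = x := by ring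
  rw [hx] at h
  simpa using h

/-- **`Γ` on the vertical line `Re = −a'`, `0 < a' < 1`**:
`‖Γ(−a' + iy)‖ ≤ (16π² + e^{π/2}/(a'(1−a'))) (1+|y|)^{3/2} e^{−π|y|/2}` for ALL real `y` (for
`|y| ≥ 1` the tree's `norm_Gamma_le_of_re_le_two`; for `|y| < 1`, `Γ(w) = Γ(w+2)/(w(w+1))` with
`|Γ(w+2)| ≤ Γ(2 − a') ≤ 1`, `|w| ≥ a'`, `|w+1| ≥ 1 − a'`). [folklore] -/
theorem norm_Gamma_neg_line_le {a' : ℝ} (ha'0 : 0 < a') (ha'1 : a' < 1) (y : ℝ) :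
    ‖Complex.Gamma ((-a' : ℝ) + y * I)‖ ≤
      (16 * π ^ 2 + Real.exp (π / 2) / (a' * (1 - a'))) * (1 + |y|) ^ (3 / 2 : ℝ) *
        Real.exp (-(π * |y|) / 2) := by
  have hK : 0 ≤ Real.exp (π / 2) / (a' * (1 - a')) := by
    have : 0 < 1 - a' := by linarith
    positivity
  rcases le_or_gt 1 |y| with hy | hy
  · calc ‖Complex.Gamma ((-a' : ℝ) + y * I)‖
        ≤ 16 * π ^ 2 * (1 + |y|) ^ (3 / 2 : ℝ) * Real.exp (-(π * |y|) / 2) :=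
          Literature.Analysis.Complex.norm_Gamma_le_of_re_le_two (by linarith) hy
      _ ≤ _ := by gcongr; linarith
  · set w : ℂ := (-a' : ℝ) + y * I with hw
    have hwre : w.re = -a' := by simp [hw]
    have hw0 : w ≠ 0 := by
      intro h; have := congrArg Complex.re h; rw [hwre] at this; simp at this; linarith
    have hw1 : w + 1 ≠ 0 := by
      intro h; have := congrArg Complex.re h; simp [hw] at this; linarith
    have hrec : Complex.Gamma w = Complex.Gamma (w + 2) / (w * (w + 1)) := by
      rw [show w + 2 = w + 1 + 1 by ring, Complex.Gamma_add_one _ hw1, Complex.Gamma_add_one w hw0]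
      field_simp
    have hw2 : w + 2 = ((2 - a' : ℝ) : ℂ) + y * I := by rw [hw]; push_cast; ring
    have hnum : ‖Complex.Gamma (w + 2)‖ ≤ 1 := by
      rw [hw2]
      refine (Literature.Analysis.SpecialFunctions.GammaVert.norm_Gamma_le_Gamma_re
        (by linarith) y).trans ?_
      exact Real_Gamma_le_one (by linarith) (by linarith)
    have hden1 : a' ≤ ‖w‖ := by
      have := Complex.abs_re_le_norm w
      rw [hwre, abs_neg, abs_of_pos ha'0] at this; exact this
    have hden2 : 1 - a' ≤ ‖w + 1‖ := by
      have := Complex.abs_re_le_norm (w + 1)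
      have hre : (w + 1).re = 1 - a' := by simp [hw]; ring
      rw [hre, abs_of_pos (by linarith)] at this; exact this
    have hden : a' * (1 - a') ≤ ‖w * (w + 1)‖ := by
      rw [norm_mul]; exact mul_le_mul hden1 hden2 (by linarith) (norm_nonneg _)
    have hpos : 0 < a' * (1 - a') := mul_pos ha'0 (by linarith)
    have h1 : ‖Complex.Gamma w‖ ≤ 1 / (a' * (1 - a')) := by
      rw [hrec, norm_div]
      exact div_le_div₀ zero_le_one hnum hpos hden
    have h2 : Real.exp (-(π / 2)) ≤ (1 + |y|) ^ (3 / 2 : ℝ) * Real.exp (-(π * |y|) / 2) := by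
      have h3 : (1 : ℝ) ≤ (1 + |y|) ^ (3 / 2 : ℝ) :=
        Real.one_le_rpow (by linarith [abs_nonneg y]) (by norm_num)
      have h4 : Real.exp (-(π / 2)) ≤ Real.exp (-(π * |y|) / 2) :=
        Real.exp_le_exp.mpr (by nlinarith [Real.pi_pos, abs_nonneg y])
      nlinarith [Real.exp_pos (-(π * |y|) / 2)]
    calc ‖Complex.Gamma w‖ ≤ 1 / (a' * (1 - a')) := h1
      _ = (Real.exp (π / 2) / (a' * (1 - a'))) * Real.exp (-(π / 2)) := by
          rw [Real.exp_neg]; field_simp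
      _ ≤ (Real.exp (π / 2) / (a' * (1 - a'))) *
            ((1 + |y|) ^ (3 / 2 : ℝ) * Real.exp (-(π * |y|) / 2)) := by gcongr
      _ ≤ (16 * π ^ 2 + Real.exp (π / 2) / (a' * (1 - a'))) *
            ((1 + |y|) ^ (3 / 2 : ℝ) * Real.exp (-(π * |y|) / 2)) := by
          gcongr; linarith [show (0:ℝ) ≤ 16 * π ^ 2 by positivity]
      _ = _ := by ring

/-- The majorant of `norm_Gamma_neg_line_le` is monotone in the strip `a₁ ≤ a' ≤ a₂`:
`e^{π/2}/(a'(1−a')) ≤ e^{π/2}/(a₁(1−a₂))`. [folklore] -/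
theorem gammaLineConst_mono {a₁ a₂ a' : ℝ} (h₁ : 0 < a₁) (h₂ : a₂ < 1) (ha1 : a₁ ≤ a')
    (ha2 : a' ≤ a₂) :
    16 * π ^ 2 + Real.exp (π / 2) / (a' * (1 - a')) ≤
      16 * π ^ 2 + Real.exp (π / 2) / (a₁ * (1 - a₂)) := by
  have : 0 < 1 - a₂ := by linarith
  have hprod : a₁ * (1 - a₂) ≤ a' * (1 - a') :=
    mul_le_mul ha1 (by linarith) this.le (by linarith)
  gcongr

/-- `Γ` is continuous along a vertical line `Re = x` with `−1 < x`, `x ≠ 0`. [folklore] -/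
theorem continuous_Gamma_neg_line {x : ℝ} (hx0 : x ≠ 0) (hx1 : -1 < x) :
    Continuous fun y : ℝ ↦ Complex.Gamma (x + y * I) := by
  refine continuous_iff_continuousAt.2 fun y ↦ ?_
  have hΓ : DifferentiableAt ℂ Complex.Gamma ((x : ℂ) + y * I) := by
    refine Complex.differentiableAt_Gamma _ fun m h ↦ ?_
    have h1 := congrArg Complex.re h
    simp only [add_re, ofReal_re, mul_re, I_re, mul_zero, ofReal_im, I_im, mul_one, sub_self,
      add_zero, neg_re, natCast_re] at h1
    rcases Nat.eq_zero_or_pos m with rfl | hm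
    · simp at h1; exact hx0 h1
    · have : (1 : ℝ) ≤ m := by exact_mod_cast hm
      linarith
  exact ContinuousAt.comp (f := fun y : ℝ ↦ (x : ℂ) + y * I) hΓ.continuousAt (by fun_prop)

end ClassMeanSquare

/-! ### The smoothed Dirichlet series: Cahen–Mellin and the shift of the line -/

set_option maxHeartbeats 800000 in
/-- **Mellin smoothing of `Z_a`.** For `|a| ≤ 1`, `1/2 < Re s < 1`, `0 < a' < 1` with
`Re s − a' ≥ −1/2`, and `X > 0`:

`Σ_n c_a(n) n^{−s} e^{−n/X} = Z_a(s) + Z₁_a(1) Γ(1−s) X^{1−s}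
   + (1/2π) ∫ Z_a(s − a' + iy) Γ(−a' + iy) X^{−a'+iy} dy`,

i.e. `(1/2πi)∫_{(c)} Z_a(s+w)Γ(w)X^w dw` (Cahen–Mellin, `c = 3/2 − Re s`) shifted to `Re w = −a'`
past the simple poles at `w = 0` (residue `Z_a(s)`) and `w = 1 − s` (residue
`Res_{z=1}Z_a · Γ(1−s)X^{1−s}`, `Res_{z=1} Z_a = Z₁_a(1)`), the horizontal sides being negligible
by the polynomial growth of `Z_a` and the decay of `Γ`. [cite: Titchmarsh1986, §2.7, §2.15 (method)] -/
theorem smoothedSum_eq (a : ClassGroup (𝓞 K) → ℂ) (ha : ∀ C, ‖a C‖ ≤ 1) {s : ℂ}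
    (hσ₁ : 1 / 2 < s.re) (hσ₂ : s.re < 1) {a' : ℝ} (ha'0 : 0 < a') (ha'1 : a' < 1)
    (hσa : -1 / 2 ≤ s.re - a') (hσa2 : s.re - a' ≤ 1 / 2) {X : ℝ} (hX : 0 < X) :
    (∑' n : ℕ, classCoeff K a n * (n : ℂ) ^ (-s) * (Real.exp (-(n / X)) : ℂ)) =
      classTwistedZeta K a s +
        classTwistedZeta₁ K a 1 * Complex.Gamma (1 - s) * (X : ℂ) ^ (1 - s) +
        (1 / (2 * π) : ℂ) * ∫ y : ℝ, classTwistedZeta K a (s + ((-a' : ℝ) + y * I)) *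
          Complex.Gamma ((-a' : ℝ) + y * I) * (X : ℂ) ^ (((-a' : ℝ) : ℂ) + y * I) := by
  set σ : ℝ := s.re with hσ_def
  set c : ℝ := 3 / 2 - σ with hc_def
  have hc0 : 0 < c := by rw [hc_def]; linarith
  have hc2 : c ≤ 2 := by rw [hc_def]; linarith
  have hs1 : s ≠ 1 := fun h ↦ by
    have : σ = 1 := by rw [hσ_def, h, Complex.one_re]
    linarith
  have hX0 : (X : ℂ) ≠ 0 := by exact_mod_cast hX.ne'
  set n₀ : ℕ := Module.finrank ℚ K with hn₀
  set dK : ℝ := ((NumberField.discr K).natAbs : ℝ) with hdK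
  set Z : ℂ → ℂ := classTwistedZeta K a with hZ_def
  set F : ℂ → ℂ := fun w ↦ Z (s + w) * Complex.Gamma w * (X : ℂ) ^ w with hF_def
  -- ### Step 1: Cahen–Mellin on the line `c`
  set b : ℕ → ℂ := fun n ↦ classCoeff K a n * (n : ℂ) ^ (-s) with hb_def
  have hterm : ∀ (z : ℂ) (n : ℕ), LSeries.term b z n = LSeries.term (classCoeff K a) (s + z) n := by
    intro z n
    rcases eq_or_ne n 0 with rfl | hn
    · simp
    · have hn' : (n : ℂ) ≠ 0 := by exact_mod_cast hn
      rw [LSeries.term_of_ne_zero hn, LSeries.term_of_ne_zero hn, hb_def]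
      simp only
      rw [Complex.cpow_add _ _ hn', Complex.cpow_neg]
      field_simp
  have hLb : ∀ z : ℂ, LSeries b z = LSeries (classCoeff K a) (s + z) := fun z ↦
    tsum_congr (hterm z)
  have hbsum : LSeriesSummable b c := by
    have h := LSeriesSummable_classCoeff ha (z := s + c) (by simp [hc_def, hσ_def]; linarith)
    exact h.congr fun n ↦ (hterm c n).symm
  have hCM := Literature.Analysis.Complex.tsum_mul_exp_neg_eq_integral_LSeries b hc0 hc2 hbsum
    (w := 1 / X) (by positivity)
  -- the left-hand sides agree
  have hLHS : (∑' n : ℕ, classCoeff K a n * (n : ℂ) ^ (-s) * (Real.exp (-(n / X)) : ℂ)) =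
      ∑' n : ℕ, (if n = 0 then 0 else b n * (Real.exp (-(n * (1 / X))) : ℂ)) := by
    refine tsum_congr fun n ↦ ?_
    rcases eq_or_ne n 0 with rfl | hn
    · simp [classCoeff_zero]
    · rw [if_neg hn, hb_def]
      simp only
      congr 3
      field_simp
  -- the integrands on the line `c` agree with `F`
  have hFc : ∀ y : ℝ, LSeries b (c + y * I) * ((((1 / X : ℝ)) : ℂ) ^ (-((c : ℂ) + y * I)) *
      Complex.Gamma (c + y * I)) = F (c + y * I) := by
    intro y
    have hre : 1 < (s + (c + y * I)).re := by simp [hc_def, hσ_def]; linarith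
    simp only [hF_def, hZ_def]
    rw [hLb, classTwistedZeta_eq_LSeries a hre]
    have hinv : (((1 / X : ℝ)) : ℂ) ^ (-((c : ℂ) + y * I)) = (X : ℂ) ^ ((c : ℂ) + y * I) := by
      rw [show (((1 / X : ℝ)) : ℂ) = (X : ℂ)⁻¹ by push_cast; ring, Complex.inv_cpow, Complex.cpow_neg,
        inv_inv]
      rw [Complex.arg_ofReal_of_nonneg hX.le]; exact Real.pi_ne_zero.symm
    rw [hinv]; ring
  -- ### Step 2: the residue theorem between `Re w = -a'` and `Re w = c`
  set S : Finset ℂ := {0, 1 - s} with hS_def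
  set r : ℂ → ℂ := fun p ↦ if p = 0 then Z s else
    classTwistedZeta₁ K a 1 * Complex.Gamma (1 - s) * (X : ℂ) ^ (1 - s) with hr_def
  have h1s0 : (1 : ℂ) - s ≠ 0 := sub_ne_zero.mpr (Ne.symm hs1)
  set U : Set ℂ := {w | -1 < w.re} with hU_def
  have hU : IsOpen U := isOpen_lt continuous_const Complex.continuous_re
  have hKU : re ⁻¹' Icc (-a') c ⊆ U := fun w hw ↦ by
    simp only [hU_def, Set.mem_setOf_eq]; linarith [hw.1]
  have hS : ∀ p ∈ S, p.re ∈ Ioo (-a') c := by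
    intro p hp
    simp only [hS_def, Finset.mem_insert, Finset.mem_singleton] at hp
    rcases hp with rfl | rfl
    · simp only [Complex.zero_re, Set.mem_Ioo]; constructor <;> linarith
    · simp only [Complex.sub_re, Complex.one_re, Set.mem_Ioo, hc_def, ← hσ_def]; constructor <;> linarith
  -- `Γ` is holomorphic on `U ∖ {0}`
  have hΓU : ∀ w ∈ U, w ≠ 0 → DifferentiableAt ℂ Complex.Gamma w := by
    intro w hw hw0
    refine Complex.differentiableAt_Gamma w fun m hm ↦ ?_
    have hwU : -1 < w.re := hw
    rcases Nat.eq_zero_or_pos m with rfl | hmpos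
    · exact hw0 (by simpa using hm)
    · rw [hm] at hwU
      simp only [neg_re, natCast_re] at hwU
      have : (1 : ℝ) ≤ m := by exact_mod_cast hmpos
      linarith
  have hF : DifferentiableOn ℂ F (U \ ↑S) := by
    intro w hw
    have hwS : w ∉ (↑S : Set ℂ) := hw.2
    simp only [hS_def, Finset.coe_insert, Finset.coe_singleton, Set.mem_insert_iff,
      Set.mem_singleton_iff, not_or] at hwS
    refine DifferentiableAt.differentiableWithinAt ?_
    have hZw : DifferentiableAt ℂ (fun w ↦ Z (s + w)) w := by
      have h1 : s + w ≠ 1 := fun h ↦ hwS.2 (by rw [← h]; ring)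
      exact (differentiableAt_classTwistedZeta a h1).comp w (differentiableAt_id.const_add s)
    exact (hZw.mul (hΓU w hw.1 hwS.1)).mul (differentiableAt_id.const_cpow (Or.inl hX0))
  -- the simple poles
  have hpole : ∀ p ∈ S, ∃ φ : ℂ → ℂ, ∃ V ∈ 𝓝 p, DifferentiableOn ℂ φ V ∧ φ p = r p ∧
      ∀ z ∈ V, z ≠ p → F z = φ z / (z - p) := by
    intro p hp
    simp only [hS_def, Finset.mem_insert, Finset.mem_singleton] at hp
    rcases hp with rfl | rfl
    · -- the pole of `Γ` at `0`
      set ρ₀ : ℝ := min (‖(1 : ℂ) - s‖ / 2) (1 / 2) with hρ₀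
      have hρ₀pos : 0 < ρ₀ := lt_min (by positivity) (by norm_num)
      refine ⟨fun w ↦ Z (s + w) * Complex.Gamma (w + 1) * (X : ℂ) ^ w, Metric.ball 0 ρ₀,
        Metric.ball_mem_nhds _ hρ₀pos, ?_, ?_, ?_⟩
      · intro w hw
        rw [Metric.mem_ball, dist_zero_right] at hw
        refine DifferentiableAt.differentiableWithinAt ?_
        have h1 : s + w ≠ 1 := by
          intro h
          have : w = 1 - s := by rw [← h]; ring
          rw [this] at hw
          have := min_le_left (‖(1 : ℂ) - s‖ / 2) (1 / 2)
          linarith [norm_pos_iff.mpr h1s0]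
        have hZw : DifferentiableAt ℂ (fun w ↦ Z (s + w)) w :=
          (differentiableAt_classTwistedZeta a h1).comp w (differentiableAt_id.const_add s)
        have hΓ1 : DifferentiableAt ℂ (fun w ↦ Complex.Gamma (w + 1)) w := by
          refine (Complex.differentiableAt_Gamma _ fun m hm ↦ ?_).comp w
            (differentiableAt_id.add_const 1)
          have h2 := congrArg Complex.re hm
          simp only [add_re, one_re, neg_re, natCast_re] at h2
          have h3 : |w.re| < 1 / 2 := lt_of_le_of_lt (Complex.abs_re_le_norm w)
            (lt_of_lt_of_le hw (min_le_right _ _))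
          have h4 : (0 : ℝ) ≤ m := Nat.cast_nonneg m
          rw [abs_lt] at h3
          linarith
        exact (hZw.mul hΓ1).mul (differentiableAt_id.const_cpow (Or.inl hX0))
      · simp [hr_def, Complex.Gamma_one, Complex.cpow_zero]
      · intro z _ hz0
        simp only [hF_def]
        rw [sub_zero, Complex.Gamma_add_one z hz0]
        field_simp
    · -- the pole of `Z_a(s + w)` at `w = 1 - s`
      set ρ₁ : ℝ := (1 - σ) / 2 with hρ₁
      have hρ₁pos : 0 < ρ₁ := by rw [hρ₁]; linarith
      refine ⟨fun w ↦ classTwistedZeta₁ K a (s + w) * Complex.Gamma w * (X : ℂ) ^ w,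
        Metric.ball (1 - s) ρ₁, Metric.ball_mem_nhds _ hρ₁pos, ?_, ?_, ?_⟩
      · intro w hw
        rw [Metric.mem_ball, dist_eq_norm] at hw
        refine DifferentiableAt.differentiableWithinAt ?_
        have hwre : 0 < w.re := by
          have h1 : |(w - (1 - s)).re| < ρ₁ := lt_of_le_of_lt (Complex.abs_re_le_norm _) hw
          simp only [sub_re, one_re, ← hσ_def] at h1
          rw [abs_lt, hρ₁] at h1
          linarith
        have hZ1 : DifferentiableAt ℂ (fun w ↦ classTwistedZeta₁ K a (s + w)) w :=
          ((differentiable_classTwistedZeta₁ a) (s + w)).comp w (differentiableAt_id.const_add s)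
        have hΓw : DifferentiableAt ℂ Complex.Gamma w := by
          refine Complex.differentiableAt_Gamma _ fun m hm ↦ ?_
          rw [hm] at hwre; simp at hwre; linarith [(Nat.cast_nonneg m : (0:ℝ) ≤ m)]
        exact (hZ1.mul hΓw).mul (differentiableAt_id.const_cpow (Or.inl hX0))
      · simp only [hr_def, if_neg h1s0]
        congr 2
        ring_nf
      · intro z _ hzp
        simp only [hF_def, hZ_def]
        have hsz1 : s + z ≠ 1 := fun h ↦ hzp (by rw [← h]; ring)
        have h1 := classTwistedZeta₁_apply_of_ne_one a hsz1
        have hne : z - (1 - s) ≠ 0 := sub_ne_zero.mpr hzp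
        rw [h1, show s + z - 1 = z - (1 - s) by ring]
        field_simp
  -- continuity of `F` along admissible vertical lines
  have hcontF : ∀ x : ℝ, x ≠ 1 - σ → -1 < x → x < 0 ∨ 0 < x →
      Continuous fun y : ℝ ↦ F (x + y * I) := by
    intro x hx1 hxm hx0
    have hZc : Continuous fun y : ℝ ↦ Z (s + (x + y * I)) := by
      have := continuous_classTwistedZeta_vertical (K := K) a (z₀ := s + x) (by
        simp [← hσ_def]; intro h; exact hx1 (by linarith))
      simpa [add_assoc] using this
    have hΓx : Continuous fun y : ℝ ↦ Complex.Gamma (x + y * I) := by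
      rcases hx0 with hx0 | hx0
      · exact ClassMeanSquare.continuous_Gamma_neg_line hx0.ne hxm
      · refine continuous_iff_continuousAt.2 fun y ↦ ?_
        have hΓ : DifferentiableAt ℂ Complex.Gamma ((x : ℂ) + y * I) :=
          Complex.differentiableAt_Gamma _ fun m h ↦ by
            have h1 := congrArg Complex.re h
            simp at h1; linarith [(Nat.cast_nonneg m : (0:ℝ) ≤ m)]
        exact ContinuousAt.comp (f := fun y : ℝ ↦ (x : ℂ) + y * I) hΓ.continuousAt (by fun_prop)
    have hXc : Continuous fun y : ℝ ↦ (X : ℂ) ^ ((x : ℂ) + y * I) :=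
      Continuous.const_cpow (by fun_prop) (Or.inl hX0)
    simp only [hF_def]
    exact (hZc.mul hΓx).mul hXc
  have h1σc : c ≠ 1 - σ := by rw [hc_def]; linarith
  have hintc : Integrable fun y : ℝ ↦ F (c + y * I) := by
    have hΓc := Literature.Analysis.SpecialFunctions.integrable_Gamma_vertical hc0 hc2
    set B₀ : ℝ := Real.exp (Module.finrank ℚ K / (1 / 2)) * X ^ c with hB₀
    have hmeas : AEStronglyMeasurable
        (fun y : ℝ ↦ Z (s + (c + y * I)) * (X : ℂ) ^ ((c : ℂ) + y * I)) volume := by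
      have h1 : Continuous fun y : ℝ ↦ Z (s + (c + y * I)) := by
        have := continuous_classTwistedZeta_vertical (K := K) a (z₀ := s + c) (by
          simp [← hσ_def, hc_def]; linarith)
        simpa [add_assoc] using this
      exact (h1.mul (Continuous.const_cpow (by fun_prop) (Or.inl hX0))).aestronglyMeasurable
    have h := hΓc.bdd_mul hmeas (c := B₀) (Eventually.of_forall fun y ↦ ?_)
    · refine h.congr (Eventually.of_forall fun y ↦ ?_)
      simp only [hF_def]
      ring
    · rw [norm_mul, Complex.norm_cpow_eq_rpow_re_of_pos hX]
      simp only [add_re, ofReal_re, mul_re, I_re, mul_zero, ofReal_im, I_im, mul_one,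
        sub_self, add_zero]
      have hre : (s + (c + y * I)).re = 3 / 2 := by simp [hc_def, hσ_def]
      have hZb := norm_classTwistedZeta_le_exp (K := K) ha (s := s + (c + y * I))
        (by rw [hre]; norm_num)
      rw [hre, show (3 / 2 : ℝ) - 1 = 1 / 2 by norm_num] at hZb
      rw [hB₀]
      exact mul_le_mul_of_nonneg_right hZb (by positivity)
  -- integrability on the left line `-a'`
  have h1σa : -a' ≠ 1 - σ := by linarith
  have hinta : Integrable fun y : ℝ ↦ F ((-a' : ℝ) + y * I) := by
    have hpi : 0 < π / 2 := by positivity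
    set Cx : ℝ := 16 * π ^ 2 + Real.exp (π / 2) / (a' * (1 - a')) with hCx
    have hCx0 : 0 ≤ Cx := by
      rw [hCx]
      have : 0 < 1 - a' := by linarith
      positivity
    set A₀ : ℝ := 2 * dK * Real.exp (2 * n₀) * (3 + ‖s‖) ^ (n₀ + 1) with hA₀
    set M₀ : ℝ := A₀ * Cx * X ^ (-a') with hM₀
    have hdom := (Literature.Analysis.SpecialFunctions.integrable_one_add_abs_rpow_mul_exp_neg hpi
      (p := (n₀ + 1 : ℕ) + 3 / 2) (by positivity)).const_mul M₀
    refine hdom.mono' ((hcontF (-a') h1σa (by linarith) (Or.inl (by linarith))).aestronglyMeasurable)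
      (Eventually.of_forall fun y ↦ ?_)
    simp only [hF_def, norm_mul]
    rw [Complex.norm_cpow_eq_rpow_re_of_pos hX]
    simp only [add_re, ofReal_re, mul_re, I_re, mul_zero, ofReal_im, I_im, mul_one,
      sub_self, add_zero]
    -- the factor `Z`
    set z : ℂ := s + ((-a' : ℝ) + y * I) with hz
    have hzre : z.re = σ - a' := by
      rw [hz]
      simp only [add_re, ofReal_re, mul_re, I_re, mul_zero, ofReal_im, I_im, mul_one, sub_self,
        add_zero, hσ_def]
      ring
    have hz1 : z ≠ 1 := fun h ↦ by
      have := congrArg Complex.re h; rw [hzre, Complex.one_re] at this; linarith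
    have hZle := norm_classTwistedZeta_le_of_re_ge (K := K) ha (z := z) (by rw [hzre]; exact hσa) hz1
    have hzm1 : 1 / 2 ≤ ‖z - 1‖ := by
      have := Complex.abs_re_le_norm (z - 1)
      rw [Complex.sub_re, hzre, Complex.one_re] at this
      have h' : 1 / 2 ≤ |σ - a' - 1| := by
        rw [abs_of_neg (by linarith)]; linarith
      linarith
    have hz52 : ‖z + 5 / 2‖ ≤ (3 + ‖s‖) * (1 + |y|) := by
      calc ‖z + 5 / 2‖ = ‖s + (5 / 2 - a' : ℝ) + (y : ℂ) * I‖ := by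
            rw [hz]; congr 1; push_cast; ring
        _ ≤ ‖s + (5 / 2 - a' : ℝ)‖ + ‖(y : ℂ) * I‖ := norm_add_le _ _
        _ ≤ (‖s‖ + ‖((5 / 2 - a' : ℝ) : ℂ)‖) + |y| := by
            gcongr
            · exact norm_add_le _ _
            · simp
        _ ≤ (‖s‖ + 3) + |y| := by
            gcongr
            rw [Complex.norm_real, Real.norm_eq_abs, abs_of_pos (by linarith)]; linarith
        _ ≤ (3 + ‖s‖) * (1 + |y|) := by nlinarith [norm_nonneg s, abs_nonneg y]
    have hZb : ‖Z z‖ ≤ A₀ * (1 + |y|) ^ (n₀ + 1) := by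
      have hnum : dK * Real.exp (2 * n₀) * ‖z + 5 / 2‖ ^ (n₀ + 1) ≤
          dK * Real.exp (2 * n₀) * ((3 + ‖s‖) * (1 + |y|)) ^ (n₀ + 1) := by gcongr
      calc ‖Z z‖ ≤ dK * Real.exp (2 * n₀) * ‖z + 5 / 2‖ ^ (n₀ + 1) / ‖z - 1‖ := hZle
        _ ≤ dK * Real.exp (2 * n₀) * ((3 + ‖s‖) * (1 + |y|)) ^ (n₀ + 1) / (1 / 2) :=
            div_le_div₀ (by positivity) hnum (by norm_num) hzm1
        _ = A₀ * (1 + |y|) ^ (n₀ + 1) := by rw [hA₀, mul_pow]; ring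
    -- the factor `Γ`
    have hΓb := ClassMeanSquare.norm_Gamma_neg_line_le ha'0 ha'1 y
    rw [← hCx] at hΓb
    have he : Real.exp (-(π * |y|) / 2) = Real.exp (-(π / 2 * |y|)) := by congr 1; ring
    have hA₀0 : 0 ≤ A₀ := by positivity
    calc ‖Z z‖ * ‖Complex.Gamma ((-a' : ℝ) + y * I)‖ * X ^ (-a')
        ≤ (A₀ * (1 + |y|) ^ (n₀ + 1)) * (Cx * (1 + |y|) ^ (3 / 2 : ℝ) * Real.exp (-(π * |y|) / 2)) *
            X ^ (-a') := by gcongr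
      _ = M₀ * ((1 + |y|) ^ (((n₀ + 1 : ℕ) : ℝ) + 3 / 2) * Real.exp (-(π / 2 * |y|))) := by
          rw [hM₀, he, Real.rpow_add (by positivity), Real.rpow_natCast]; ring
  -- decay on the horizontal segments
  have hdecay : ∀ ε : ℝ, 0 < ε → ∃ T₀ : ℝ, ∀ T : ℝ, T₀ ≤ |T| → ∀ x ∈ Icc (-a') c,
      ‖F (x + T * I)‖ ≤ ε := by
    intro ε hε
    set Xb : ℝ := X ^ c + X ^ (-a') with hXb
    have hXb0 : 0 < Xb := by positivity
    set M₁ : ℝ := dK * Real.exp (2 * n₀) * (16 * π ^ 2) * Xb with hM₁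
    have hM₁0 : 0 < M₁ := by
      have : 0 < dK := by
        rw [hdK]; exact_mod_cast Int.natAbs_pos.mpr (NumberField.discr_ne_zero K)
      positivity
    obtain ⟨T₂, hT₂⟩ := Literature.Analysis.Complex.exists_rpow_mul_exp_neg_le
      (K := 4 + ‖s‖) (p := (n₀ + 1 : ℕ) + 3 / 2) (a := π / 2) (by positivity) (by positivity)
      (by positivity) (ε := ε / M₁) (by positivity)
    refine ⟨max (‖s‖ + 2) T₂, fun T hT x hx ↦ ?_⟩
    have hT1 : ‖s‖ + 2 ≤ |T| := le_trans (le_max_left _ _) hT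
    have hT2 : T₂ ≤ |T| := le_trans (le_max_right _ _) hT
    have hT0 : 1 ≤ |T| := by linarith [norm_nonneg s]
    set z : ℂ := s + (x + T * I) with hz
    have hzre : z.re = σ + x := by simp [hz, hσ_def]
    have hzim : 1 ≤ |z.im| := by
      have h1 : z.im = s.im + T := by simp [hz]
      rw [h1]
      have h2 : |s.im| ≤ ‖s‖ := Complex.abs_im_le_norm s
      have h3 : |T| - |s.im| ≤ |s.im + T| := by
        have := abs_sub_abs_le_abs_sub T (-s.im)
        rw [abs_neg, show T - -s.im = s.im + T by ring] at this
        exact this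
      linarith
    have hz1 : z ≠ 1 := fun h ↦ by
      have := congrArg Complex.im h; simp at this; rw [this] at hzim; norm_num at hzim
    have hzm1 : 1 ≤ ‖z - 1‖ := by
      have := Complex.abs_im_le_norm (z - 1)
      simp only [Complex.sub_im, Complex.one_im, sub_zero] at this
      linarith
    have hZle := norm_classTwistedZeta_le_of_re_ge (K := K) ha (z := z)
      (by rw [hzre]; linarith [hx.1]) hz1
    have hz52 : ‖z + 5 / 2‖ ≤ 4 + ‖s‖ + |T| := by
      calc ‖z + 5 / 2‖ = ‖s + ((x + 5 / 2 : ℝ) : ℂ) + (T : ℂ) * I‖ := by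
            rw [hz]; congr 1; push_cast; ring
        _ ≤ ‖s‖ + ‖((x + 5 / 2 : ℝ) : ℂ)‖ + ‖(T : ℂ) * I‖ := norm_add₃_le
        _ ≤ ‖s‖ + 4 + |T| := by
            gcongr
            · rw [Complex.norm_real, Real.norm_eq_abs, abs_of_pos (by linarith [hx.1])]
              linarith [hx.2]
            · simp
        _ = 4 + ‖s‖ + |T| := by ring
    have hZb : ‖Z z‖ ≤ dK * Real.exp (2 * n₀) * (4 + ‖s‖ + |T|) ^ (n₀ + 1) := by
      calc ‖Z z‖ ≤ dK * Real.exp (2 * n₀) * ‖z + 5 / 2‖ ^ (n₀ + 1) / ‖z - 1‖ := hZle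
        _ ≤ dK * Real.exp (2 * n₀) * ‖z + 5 / 2‖ ^ (n₀ + 1) := div_le_self (by positivity) hzm1
        _ ≤ _ := by gcongr
    have hΓb : ‖Complex.Gamma (x + T * I)‖ ≤
        16 * π ^ 2 * (1 + |T|) ^ (3 / 2 : ℝ) * Real.exp (-(π * |T|) / 2) :=
      Literature.Analysis.Complex.norm_Gamma_le_of_re_le_two (by linarith [hx.2]) hT0
    have hXx : ‖(X : ℂ) ^ ((x : ℂ) + T * I)‖ ≤ Xb := by
      rw [Complex.norm_cpow_eq_rpow_re_of_pos hX]
      simp only [add_re, ofReal_re, mul_re, I_re, mul_zero, ofReal_im, I_im, mul_one,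
        sub_self, add_zero]
      rw [hXb]
      rcases le_or_gt 1 X with hX1 | hX1
      · have : X ^ x ≤ X ^ c := Real.rpow_le_rpow_of_exponent_le hX1 hx.2
        linarith [Real.rpow_nonneg hX.le (-a')]
      · have : X ^ x ≤ X ^ (-a') := Real.rpow_le_rpow_of_exponent_ge hX hX1.le hx.1
        linarith [Real.rpow_nonneg hX.le c]
    have h1T : (1 + |T|) ^ (3 / 2 : ℝ) ≤ (4 + ‖s‖ + |T|) ^ (3 / 2 : ℝ) :=
      Real.rpow_le_rpow (by positivity) (by linarith [norm_nonneg s]) (by norm_num)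
    have hmain := hT₂ T hT2
    have he : Real.exp (-(π * |T|) / 2) = Real.exp (-(π / 2 * |T|)) := by congr 1; ring
    have hΓb' : ‖Complex.Gamma (x + T * I)‖ ≤
        16 * π ^ 2 * (4 + ‖s‖ + |T|) ^ (3 / 2 : ℝ) * Real.exp (-(π * |T|) / 2) :=
      hΓb.trans (mul_le_mul_of_nonneg_right (mul_le_mul_of_nonneg_left h1T (by positivity))
        (Real.exp_pos _).le)
    have hFn : ‖F (x + T * I)‖ = ‖Z z‖ * ‖Complex.Gamma (x + T * I)‖ *
        ‖(X : ℂ) ^ ((x : ℂ) + T * I)‖ := by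
      rw [hF_def, hz]; simp only [norm_mul]
    calc ‖F (x + T * I)‖ = ‖Z z‖ * ‖Complex.Gamma (x + T * I)‖ * ‖(X : ℂ) ^ ((x : ℂ) + T * I)‖ :=
          hFn
      _ ≤ (dK * Real.exp (2 * n₀) * (4 + ‖s‖ + |T|) ^ (n₀ + 1)) *
            (16 * π ^ 2 * (4 + ‖s‖ + |T|) ^ (3 / 2 : ℝ) * Real.exp (-(π * |T|) / 2)) * Xb :=
          mul_le_mul (mul_le_mul hZb hΓb' (norm_nonneg _) (by positivity)) hXx (norm_nonneg _)
            (by positivity)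
      _ = M₁ * ((4 + ‖s‖ + |T|) ^ (((n₀ + 1 : ℕ) : ℝ) + 3 / 2) * Real.exp (-(π / 2 * |T|))) := by
          rw [hM₁, he, Real.rpow_add (by positivity), Real.rpow_natCast]; ring
      _ ≤ M₁ * (ε / M₁) := by gcongr
      _ = ε := by field_simp
  have hres := Literature.Analysis.Complex.integral_vertical_sub_eq_sum_of_simplePoles
    (F := F) (by linarith : -a' < c) S r U hU hKU hS hF hpole hinta hintc hdecay
  -- ### Step 3: assemble
  have hsum : ∑ p ∈ S, r p = Z s + classTwistedZeta₁ K a 1 * Complex.Gamma (1 - s) *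
      (X : ℂ) ^ (1 - s) := by
    rw [hS_def, Finset.sum_pair (Ne.symm h1s0)]
    simp only [hr_def, if_pos rfl, if_neg h1s0]
  rw [hsum] at hres
  have hint_c : (∫ y : ℝ, F (c + y * I)) =
      ∫ y : ℝ, LSeries b (c + y * I) * ((((1 / X : ℝ)) : ℂ) ^ (-((c : ℂ) + y * I)) *
        Complex.Gamma (c + y * I)) := integral_congr_ae (Eventually.of_forall fun y ↦ (hFc y).symm)
  have hc_eq : (∫ y : ℝ, F (c + y * I)) = (∫ y : ℝ, F ((-a' : ℝ) + y * I)) +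
      2 * π * (Z s + classTwistedZeta₁ K a 1 * Complex.Gamma (1 - s) * (X : ℂ) ^ (1 - s)) := by
    rw [← hres]; ring
  have hπ : (2 * π : ℂ) ≠ 0 := by exact_mod_cast (by positivity : (2 * π : ℝ) ≠ 0)
  have h2π : (1 / (2 * π) : ℂ) * (2 * π) = 1 := by field_simp
  have hFa : (fun y : ℝ ↦ F ((-a' : ℝ) + y * I)) = fun y : ℝ ↦
      classTwistedZeta K a (s + ((-a' : ℝ) + y * I)) * Complex.Gamma ((-a' : ℝ) + y * I) *
        (X : ℂ) ^ (((-a' : ℝ) : ℂ) + y * I) := by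
    funext y; simp only [hF_def, hZ_def]
  rw [hLHS, hCM, ← hint_c, hc_eq, hFa, mul_add, ← mul_assoc (1 / (2 * π) : ℂ) (2 * π : ℂ), h2π,
    one_mul, hZ_def]
  ring

namespace ClassMeanSquare

/-! ### Two real-variable lemmas: `Σ n^α e^{-n/Y}` and a weighted Cauchy–Schwarz inequality -/

/-- For `−1 < α ≤ 0` and `Y > 0`: `Σ_{n ≥ 1} n^α e^{−n/Y} ≤ 1 + Γ(α+1) Y^{α+1}` (the summand is
antitone, so the sum over `n ≥ 2` is at most `∫₀^∞ u^α e^{−u/Y} du = Γ(α+1) Y^{α+1}`). [folklore] -/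
theorem tsum_rpow_mul_exp_neg_le {α : ℝ} (hα1 : -1 < α) (hα0 : α ≤ 0) {Y : ℝ} (hY : 0 < Y) :
    (∑' n : ℕ, if n = 0 then (0 : ℝ) else (n : ℝ) ^ α * Real.exp (-(n / Y))) ≤
      1 + Real.Gamma (α + 1) * Y ^ (α + 1) := by
  set f : ℕ → ℝ := fun n ↦ if n = 0 then (0 : ℝ) else (n : ℝ) ^ α * Real.exp (-(n / Y)) with hf
  set g : ℝ → ℝ := fun u ↦ u ^ α * Real.exp (-(u / Y)) with hg
  have hg0 : ∀ u, 0 ≤ u → 0 ≤ g u := fun u hu ↦ mul_nonneg (Real.rpow_nonneg hu _) (Real.exp_pos _).le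
  have hf0 : ∀ n, 0 ≤ f n := by
    intro n; simp only [hf]; split_ifs
    · exact le_rfl
    · exact hg0 n (Nat.cast_nonneg n)
  have hfg : ∀ n : ℕ, n ≠ 0 → f n = g n := fun n hn ↦ by simp only [hf, hg, if_neg hn]
  -- the integral over `(0, ∞)`
  have hGpos : 0 < Real.Gamma (α + 1) := Real.Gamma_pos_of_pos (by linarith)
  have hint : IntegrableOn g (Ioi 0) := by
    have h := integrableOn_rpow_mul_exp_neg_mul_rpow (s := α) (p := 1) hα1 le_rfl
      (b := 1 / Y) (by positivity)
    refine h.congr_fun (fun u hu ↦ ?_) measurableSet_Ioi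
    simp only [hg, Real.rpow_one]
    congr 1; congr 1; field_simp
  have hval : ∫ u in Ioi 0, g u = Real.Gamma (α + 1) * Y ^ (α + 1) := by
    have h := Real.integral_rpow_mul_exp_neg_mul_Ioi (a := α + 1) (r := 1 / Y) (by linarith)
      (by positivity)
    rw [one_div_one_div, add_sub_cancel_right] at h
    rw [mul_comm, ← h]
    refine setIntegral_congr_fun measurableSet_Ioi fun u hu ↦ ?_
    simp only [hg]
    congr 1; congr 1; field_simp
  -- antitone
  have hanti : ∀ N : ℕ, AntitoneOn g (Icc (1 : ℝ) (1 + N)) := by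
    intro N u hu v hv huv
    have hu1 : 0 < u := by linarith [hu.1]
    simp only [hg]
    refine mul_le_mul (Real.rpow_le_rpow_of_nonpos hu1 huv hα0) ?_ (Real.exp_pos _).le
      (Real.rpow_nonneg (by linarith [hu.1]) _)
    exact Real.exp_le_exp.mpr (by rw [neg_le_neg_iff]; exact div_le_div_of_nonneg_right huv hY.le)
  -- partial sums over `n ≥ 2`
  have htail : ∀ N : ℕ, ∑ k ∈ Finset.range N, g (1 + ((k + 1 : ℕ) : ℝ)) ≤
      Real.Gamma (α + 1) * Y ^ (α + 1) := by
    intro N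
    have h1 := (hanti N).sum_le_integral
    refine h1.trans ?_
    rw [intervalIntegral.integral_of_le (le_add_of_nonneg_right (Nat.cast_nonneg N)), ← hval]
    refine setIntegral_mono_set hint ?_ (Ioc_subset_Ioi_self.trans (Ioi_subset_Ioi zero_le_one)).eventuallyLE
    filter_upwards [ae_restrict_mem measurableSet_Ioi] with u hu using hg0 u (le_of_lt hu)
  refine Real.tsum_le_of_sum_range_le hf0 fun N ↦ ?_
  have hY1 : 0 ≤ Real.Gamma (α + 1) * Y ^ (α + 1) := by positivity
  rcases le_or_gt N 2 with hN | hN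
  · -- `N ≤ 2`: the sum is at most `f 1 ≤ 1`
    have : ∑ i ∈ Finset.range N, f i ≤ ∑ i ∈ Finset.range 2, f i :=
      Finset.sum_le_sum_of_subset_of_nonneg (Finset.range_mono hN) fun i _ _ ↦ hf0 i
    refine this.trans ?_
    rw [Finset.sum_range_succ, Finset.sum_range_one]
    simp only [hf, if_pos rfl, zero_add, one_ne_zero, if_false, Nat.cast_one, Real.one_rpow, one_mul]
    have : Real.exp (-(1 / Y)) ≤ 1 := Real.exp_le_one_iff.mpr (by rw [neg_nonpos]; positivity)
    linarith
  · have h2 : ∑ i ∈ Finset.Ico 0 2, f i ≤ 1 := by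
      rw [show Finset.Ico 0 2 = Finset.range 2 from rfl, Finset.sum_range_succ, Finset.sum_range_one]
      simp only [hf, if_pos rfl, zero_add, one_ne_zero, if_false, Nat.cast_one, Real.one_rpow, one_mul]
      exact Real.exp_le_one_iff.mpr (by rw [neg_nonpos]; positivity)
    have h3 : ∑ k ∈ Finset.range (N - 2), f (2 + k) =
        ∑ k ∈ Finset.range (N - 2), g (1 + ((k + 1 : ℕ) : ℝ)) := by
      refine Finset.sum_congr rfl fun k _ ↦ ?_
      rw [hfg (2 + k) (by omega)]
      congr 1; push_cast; ring
    rw [Finset.range_eq_Ico, ← Finset.sum_Ico_consecutive f (Nat.zero_le 2) hN.le,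
      Finset.sum_Ico_eq_sum_range f 2 N, h3]
    linarith [htail (N - 2)]

/-- **Weighted Cauchy–Schwarz**: for `ρ, g ≥ 0` with `ρ`, `ρg`, `ρg²` integrable,
`(∫ ρ g)² ≤ (∫ ρ)(∫ ρ g²)` (from `2g ≤ λ + g²/λ`; the proof of the tree's
`HuxleyLargeValuesFourthMomentProofs.integral_mul_sq_le`, copied to keep the imports light).
[folklore] -/
theorem integral_mul_sq_le {ρ g : ℝ → ℝ} (hρ0 : ∀ y, 0 ≤ ρ y) (hg0 : ∀ y, 0 ≤ g y)
    (hρ : Integrable ρ) (hρg : Integrable fun y ↦ ρ y * g y)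
    (hρg2 : Integrable fun y ↦ ρ y * g y ^ 2) :
    (∫ y, ρ y * g y) ^ 2 ≤ (∫ y, ρ y) * ∫ y, ρ y * g y ^ 2 := by
  have key : ∀ {a A B : ℝ}, 0 ≤ a → 0 ≤ A → 0 ≤ B →
      (∀ lam : ℝ, 0 < lam → a ≤ (lam * A + B / lam) / 2) → a ^ 2 ≤ A * B := by
    intro a A B ha hA hB h
    rcases hA.eq_or_lt with hA0 | hA0
    · rcases hB.eq_or_lt with hB0 | hB0
      · have h1 := h 1 one_pos
        rw [← hA0, ← hB0] at h1
        norm_num at h1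
        have : a = 0 := le_antisymm h1 ha
        rw [this, ← hA0]; simp
      · by_contra hcon
        have ha0 : 0 < a := by
          rcases ha.eq_or_lt with h0 | h0
          · exact absurd (by rw [← h0, ← hA0]; simp) hcon
          · exact h0
        have h1 := h (B / a) (div_pos hB0 ha0)
        rw [← hA0] at h1
        have e : B / (B / a) = a := by field_simp
        rw [mul_zero, zero_add, e] at h1
        linarith
    · rcases hB.eq_or_lt with hB0 | hB0
      · by_contra hcon
        have ha0 : 0 < a := by
          rcases ha.eq_or_lt with h0 | h0
          · exact absurd (by rw [← h0, ← hB0]; simp) hcon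
          · exact h0
        have h1 := h (a / A) (div_pos ha0 hA0)
        rw [← hB0] at h1
        have e : a / A * A = a := div_mul_cancel₀ a hA0.ne'
        rw [zero_div, add_zero, e] at h1
        linarith
      · set lam := Real.sqrt (B / A) with hlamdef
        have hlam : 0 < lam := Real.sqrt_pos.2 (div_pos hB0 hA0)
        have hl2 : lam ^ 2 = B / A := Real.sq_sqrt (div_pos hB0 hA0).le
        have h1 := h lam hlam
        have e1 : B / lam = lam * A := by
          rw [div_eq_iff hlam.ne']
          have : B = lam ^ 2 * A := by rw [hl2]; field_simp
          rw [this]; ring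
        rw [e1] at h1
        have h2 : a ≤ lam * A := by linarith
        calc a ^ 2 ≤ (lam * A) ^ 2 := pow_le_pow_left₀ ha h2 2
          _ = lam ^ 2 * A * A := by ring
          _ = A * B := by rw [hl2]; field_simp
  refine key (integral_nonneg fun y ↦ mul_nonneg (hρ0 y) (hg0 y))
    (integral_nonneg hρ0) (integral_nonneg fun y ↦ mul_nonneg (hρ0 y) (sq_nonneg _))
    fun lam hlam ↦ ?_
  have hpt : ∀ y, ρ y * g y ≤ (lam * ρ y + ρ y * g y ^ 2 / lam) / 2 := by
    intro y
    have hρy := hρ0 y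
    have h2 : 2 * g y ≤ lam + g y ^ 2 / lam := by
      have h := sq_nonneg (g y - lam)
      have e : lam + g y ^ 2 / lam - 2 * g y = (g y - lam) ^ 2 / lam := by
        field_simp; ring
      have : 0 ≤ lam + g y ^ 2 / lam - 2 * g y := by rw [e]; positivity
      linarith
    have := mul_le_mul_of_nonneg_left h2 hρy
    have e2 : (lam * ρ y + ρ y * g y ^ 2 / lam) / 2 = ρ y * (lam + g y ^ 2 / lam) / 2 := by ring
    rw [e2]
    linarith
  have hI1 : Integrable fun y ↦ (lam * ρ y + ρ y * g y ^ 2 / lam) / 2 :=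
    ((hρ.const_mul lam).add (hρg2.div_const lam)).div_const 2
  calc ∫ y, ρ y * g y ≤ ∫ y, (lam * ρ y + ρ y * g y ^ 2 / lam) / 2 := integral_mono hρg hI1 hpt
    _ = (lam * (∫ y, ρ y) + (∫ y, ρ y * g y ^ 2) / lam) / 2 := by
        rw [integral_div, integral_add (hρ.const_mul lam) (hρg2.div_const lam), integral_const_mul,
          integral_div]

end ClassMeanSquare

/-! ### Mean square of the smoothed Dirichlet series (Montgomery–Vaughan) -/

/-- **Mean square of the smoothed sum**, uniformly in `σ₀ ≥ σ₁`: for `|a| ≤ 1`, `0 < ε`,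
`1/2 + ε < σ₁ < 1` there is `C` with
`∫_{−T}^{T} |Σ_n c_a(n) n^{−σ₀−it} e^{−n/X}|² dt ≤ C (T + X^{2 − 2σ₁ + 2ε})`
for all `σ₀ ≥ σ₁`, `X ≥ 1`, `T ≥ 1` (the tree's sharp mean value theorem
`DirichletMVT.meanSquare_tsum_shift_le`, `|c_a(n)| ≤ c_K(n) ≪ n^ε`, and
`Σ n^{1+2ε−2σ₁} e^{−2n/X} ≪ X^{2−2σ₁+2ε}`). [cite: MontgomeryVaughan1974, Corollary 3] -/
theorem meanSquare_smoothedSum_le {σ₁ ε : ℝ} (hε : 0 < ε) (hσε : 1 / 2 + ε < σ₁) (hσ₁ : σ₁ < 1) :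
    ∃ C : ℝ, 0 < C ∧ ∀ (a : ClassGroup (𝓞 K) → ℂ), (∀ C, ‖a C‖ ≤ 1) →
      ∀ (σ₀ X T : ℝ), σ₁ ≤ σ₀ → 1 ≤ X → 1 ≤ T →
      ∫ t in (-T)..T, ‖∑' n : ℕ, classCoeff K a n * (n : ℂ) ^ (-((σ₀ : ℂ) + t * I)) *
        (Real.exp (-(n / X)) : ℂ)‖ ^ 2 ≤ C * (T + X ^ (2 - 2 * σ₁ + 2 * ε)) := by
  obtain ⟨Cd, hCd1, hCd⟩ := exists_idealNormCount_le_rpow (K := K) hε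
  have hCd0 : 0 < Cd := by linarith
  -- the two real constants
  set p : ℝ := 2 * σ₁ - 2 * ε with hp
  have hp1 : 1 < p := by rw [hp]; linarith
  have hS₁sum : Summable fun n : ℕ ↦ (n : ℝ) ^ (-p) := Real.summable_nat_rpow.mpr (by linarith)
  set S₁ : ℝ := ∑' n : ℕ, (n : ℝ) ^ (-p) with hS₁
  have hS₁0 : 0 ≤ S₁ := tsum_nonneg fun n ↦ Real.rpow_nonneg (Nat.cast_nonneg n) _
  set α : ℝ := 1 + 2 * ε - 2 * σ₁ with hα
  have hα1 : -1 < α := by rw [hα]; linarith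
  have hα0 : α ≤ 0 := by rw [hα]; linarith
  set G : ℝ := 1 + Real.Gamma (α + 1) with hG
  have hG0 : 0 < G := by
    have := Real.Gamma_pos_of_pos (by linarith : 0 < α + 1); rw [hG]; linarith
  refine ⟨Cd ^ 2 * (25 * S₁ + 65 * G), by positivity, fun a ha σ₀ X T hσ₀ hX hT ↦ ?_⟩
  have hX0 : 0 < X := by linarith
  -- the coefficients
  set c : ℕ → ℂ := fun n ↦ classCoeff K a n * (n : ℂ) ^ (-(σ₀ : ℂ)) * (Real.exp (-(n / X)) : ℂ)
    with hc
  have hc0 : c 0 = 0 := by simp [hc, classCoeff_zero]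
  have hcn : ∀ n : ℕ, n ≠ 0 → ‖c n‖ ≤ Cd * (n : ℝ) ^ (ε - σ₀) * Real.exp (-(n / X)) := by
    intro n hn
    have hnpos : 0 < (n : ℝ) := by exact_mod_cast Nat.pos_of_ne_zero hn
    simp only [hc, norm_mul]
    rw [Complex.norm_natCast_cpow_of_pos (Nat.pos_of_ne_zero hn), Complex.norm_real,
      Real.norm_eq_abs, abs_of_pos (Real.exp_pos _)]
    simp only [Complex.neg_re, Complex.ofReal_re]
    have h1 : ‖classCoeff K a n‖ ≤ Cd * (n : ℝ) ^ ε := (norm_classCoeff_le ha n).trans (hCd n hn)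
    have hsplit : (n : ℝ) ^ (ε - σ₀) = (n : ℝ) ^ ε * (n : ℝ) ^ (-σ₀) := by
      rw [sub_eq_add_neg, Real.rpow_add hnpos]
    calc ‖classCoeff K a n‖ * (n : ℝ) ^ (-σ₀) * Real.exp (-(n / X))
        ≤ (Cd * (n : ℝ) ^ ε) * (n : ℝ) ^ (-σ₀) * Real.exp (-(n / X)) := by gcongr
      _ = Cd * (n : ℝ) ^ (ε - σ₀) * Real.exp (-(n / X)) := by rw [hsplit]; ring
  -- `‖c n‖ ≤ Cd n^{ε-σ₁} e^{-n/X} ≤ Cd e^{-n/X}` and `‖c n‖² ≤ Cd² n^{2ε-2σ₁} e^{-2n/X}`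
  have hcn' : ∀ n : ℕ, n ≠ 0 → ‖c n‖ ≤ Cd * (n : ℝ) ^ (ε - σ₁) * Real.exp (-(n / X)) := by
    intro n hn
    have hn1 : (1 : ℝ) ≤ n := by exact_mod_cast Nat.pos_of_ne_zero hn
    refine (hcn n hn).trans ?_
    gcongr
  have hexp_sum : ∀ κ : ℝ, 0 < κ → Summable fun n : ℕ ↦ Real.exp (-(n / κ)) := by
    intro κ hκ
    have := Real.summable_exp_nat_mul_iff.mpr (show -(1 / κ) < 0 by rw [neg_lt_zero]; positivity)
    refine this.congr fun n ↦ ?_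
    congr 1; field_simp
  have hsum1 : Summable fun n : ℕ ↦ ‖c n‖ := by
    refine Summable.of_nonneg_of_le (fun n ↦ norm_nonneg _) (fun n ↦ ?_)
      ((hexp_sum X hX0).mul_left Cd)
    rcases eq_or_ne n 0 with rfl | hn
    · rw [hc0, norm_zero]; positivity
    · have hn1 : (1 : ℝ) ≤ n := by exact_mod_cast Nat.pos_of_ne_zero hn
      refine (hcn' n hn).trans ?_
      have : (n : ℝ) ^ (ε - σ₁) ≤ 1 := Real.rpow_le_one_of_one_le_of_nonpos hn1 (by linarith)
      calc Cd * (n : ℝ) ^ (ε - σ₁) * Real.exp (-(n / X)) ≤ Cd * 1 * Real.exp (-(n / X)) := by gcongr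
        _ = Cd * Real.exp (-(n / X)) := by ring
  have hsq : ∀ n : ℕ, n ≠ 0 → ‖c n‖ ^ 2 ≤
      Cd ^ 2 * ((n : ℝ) ^ (-p) * Real.exp (-(n / (X / 2)))) := by
    intro n hn
    have hnpos : 0 < (n : ℝ) := by exact_mod_cast Nat.pos_of_ne_zero hn
    have h0 : 0 ≤ Cd * (n : ℝ) ^ (ε - σ₁) * Real.exp (-(n / X)) := by positivity
    calc ‖c n‖ ^ 2 ≤ (Cd * (n : ℝ) ^ (ε - σ₁) * Real.exp (-(n / X))) ^ 2 :=
          pow_le_pow_left₀ (norm_nonneg _) (hcn' n hn) 2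
      _ = Cd ^ 2 * ((n : ℝ) ^ (-p) * Real.exp (-(n / (X / 2)))) := by
          have e1 : ((n : ℝ) ^ (ε - σ₁)) ^ 2 = (n : ℝ) ^ (-p) := by
            rw [← Real.rpow_natCast, ← Real.rpow_mul hnpos.le]; congr 1; rw [hp]; push_cast; ring
          have e2 : (Real.exp (-(n / X))) ^ 2 = Real.exp (-(n / (X / 2))) := by
            rw [← Real.exp_nat_mul]; congr 1; push_cast; field_simp
          rw [mul_pow, mul_pow, e1, e2]; ring
  have hsum2 : Summable fun n : ℕ ↦ (n : ℝ) * ‖c n‖ ^ 2 := by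
    refine Summable.of_nonneg_of_le (fun n ↦ by positivity) (fun n ↦ ?_)
      ((hexp_sum (X / 2) (by positivity)).mul_left (Cd ^ 2))
    rcases eq_or_ne n 0 with rfl | hn
    · simp; positivity
    · have hnpos : 0 < (n : ℝ) := by exact_mod_cast Nat.pos_of_ne_zero hn
      have hn1 : (1 : ℝ) ≤ n := by exact_mod_cast Nat.pos_of_ne_zero hn
      calc (n : ℝ) * ‖c n‖ ^ 2 ≤ (n : ℝ) * (Cd ^ 2 * ((n : ℝ) ^ (-p) * Real.exp (-(n / (X / 2))))) := by
            gcongr; exact hsq n hn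
        _ = Cd ^ 2 * ((n : ℝ) ^ (1 - p) * Real.exp (-(n / (X / 2)))) := by
            rw [sub_eq_add_neg, Real.rpow_add hnpos, Real.rpow_one]; ring
        _ ≤ Cd ^ 2 * (1 * Real.exp (-(n / (X / 2)))) := by
            gcongr
            exact Real.rpow_le_one_of_one_le_of_nonpos hn1 (by linarith)
        _ = Cd ^ 2 * Real.exp (-(n / (X / 2))) := by ring
  -- the mean value theorem
  have hMVT := DirichletMVT.meanSquare_tsum_shift_le hsum1 hsum2 hc0 (W := T) (by linarith) 0
  rw [zero_sub, zero_add] at hMVT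
  -- identify the integrands
  have hint_eq : ∀ t : ℝ, (∑' n : ℕ, classCoeff K a n * (n : ℂ) ^ (-((σ₀ : ℂ) + t * I)) *
      (Real.exp (-(n / X)) : ℂ)) = ∑' n : ℕ, c n * (n : ℂ) ^ (-((t : ℂ) * I)) := by
    intro t
    refine tsum_congr fun n ↦ ?_
    rcases eq_or_ne n 0 with rfl | hn
    · simp [classCoeff_zero, hc0]
    · have hn' : (n : ℂ) ≠ 0 := by exact_mod_cast hn
      simp only [hc]
      rw [neg_add, Complex.cpow_add _ _ hn']
      ring
  simp_rw [hint_eq]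
  refine hMVT.trans ?_
  -- bound the coefficient sum
  have hterm_le : ∀ n : ℕ, (5 * T + 20 + 65 * (n : ℝ)) * ‖c n‖ ^ 2 ≤
      Cd ^ 2 * ((5 * T + 20) * (n : ℝ) ^ (-p)) +
        Cd ^ 2 * (65 * (if n = 0 then (0 : ℝ) else (n : ℝ) ^ α * Real.exp (-(n / (X / 2))))) := by
    intro n
    rcases eq_or_ne n 0 with rfl | hn
    · simp [hc0]; positivity
    · have hnpos : 0 < (n : ℝ) := by exact_mod_cast Nat.pos_of_ne_zero hn
      rw [if_neg hn]
      have h1 := hsq n hn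
      have hexp1 : Real.exp (-(n / (X / 2))) ≤ 1 :=
        Real.exp_le_one_iff.mpr (by rw [neg_nonpos]; positivity)
      have hnp : (n : ℝ) * ((n : ℝ) ^ (-p) * Real.exp (-(n / (X / 2)))) =
          (n : ℝ) ^ α * Real.exp (-(n / (X / 2))) := by
        rw [← mul_assoc, ← Real.rpow_one_add' hnpos.le (by rw [hp]; linarith), hp, hα]
        congr 2; ring
      calc (5 * T + 20 + 65 * (n : ℝ)) * ‖c n‖ ^ 2
          = (5 * T + 20) * ‖c n‖ ^ 2 + 65 * ((n : ℝ) * ‖c n‖ ^ 2) := by ring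
        _ ≤ (5 * T + 20) * (Cd ^ 2 * ((n : ℝ) ^ (-p) * Real.exp (-(n / (X / 2))))) +
              65 * ((n : ℝ) * (Cd ^ 2 * ((n : ℝ) ^ (-p) * Real.exp (-(n / (X / 2)))))) := by
            gcongr
        _ ≤ (5 * T + 20) * (Cd ^ 2 * ((n : ℝ) ^ (-p) * 1)) +
              65 * ((n : ℝ) * (Cd ^ 2 * ((n : ℝ) ^ (-p) * Real.exp (-(n / (X / 2)))))) := by
            gcongr
        _ = Cd ^ 2 * ((5 * T + 20) * (n : ℝ) ^ (-p)) +
              Cd ^ 2 * (65 * ((n : ℝ) ^ α * Real.exp (-(n / (X / 2))))) := by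
            rw [← hnp]; ring
  have hsumA : Summable fun n : ℕ ↦ Cd ^ 2 * ((5 * T + 20) * (n : ℝ) ^ (-p)) :=
    (hS₁sum.mul_left (5 * T + 20)).mul_left (Cd ^ 2)
  have hB := ClassMeanSquare.tsum_rpow_mul_exp_neg_le hα1 hα0 (Y := X / 2) (by positivity)
  have hsumB0 : Summable fun n : ℕ ↦
      (if n = 0 then (0 : ℝ) else (n : ℝ) ^ α * Real.exp (-(n / (X / 2)))) := by
    refine Summable.of_nonneg_of_le (fun n ↦ ?_) (fun n ↦ ?_) (hexp_sum (X / 2) (by positivity))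
    · split_ifs
      · exact le_rfl
      · positivity
    · split_ifs with hn
      · positivity
      · have hn1 : (1 : ℝ) ≤ n := by exact_mod_cast Nat.pos_of_ne_zero hn
        calc (n : ℝ) ^ α * Real.exp (-(n / (X / 2))) ≤ 1 * Real.exp (-(n / (X / 2))) := by
              gcongr; exact Real.rpow_le_one_of_one_le_of_nonpos hn1 hα0
          _ = _ := one_mul _
  have hsumB : Summable fun n : ℕ ↦ Cd ^ 2 *
      (65 * (if n = 0 then (0 : ℝ) else (n : ℝ) ^ α * Real.exp (-(n / (X / 2))))) :=
    (hsumB0.mul_left 65).mul_left (Cd ^ 2)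
  have hlhs_sum : Summable fun n : ℕ ↦ (5 * T + 20 + 65 * (n : ℝ)) * ‖c n‖ ^ 2 := by
    refine Summable.of_nonneg_of_le (fun n ↦ by positivity) hterm_le (hsumA.add hsumB)
  calc ∑' n : ℕ, (5 * T + 20 + 65 * (n : ℝ)) * ‖c n‖ ^ 2
      ≤ ∑' n : ℕ, (Cd ^ 2 * ((5 * T + 20) * (n : ℝ) ^ (-p)) +
          Cd ^ 2 * (65 * (if n = 0 then (0 : ℝ) else (n : ℝ) ^ α * Real.exp (-(n / (X / 2)))))) :=
        hlhs_sum.tsum_le_tsum hterm_le (hsumA.add hsumB)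
    _ = Cd ^ 2 * ((5 * T + 20) * S₁) + Cd ^ 2 * (65 *
          ∑' n : ℕ, (if n = 0 then (0 : ℝ) else (n : ℝ) ^ α * Real.exp (-(n / (X / 2))))) := by
        rw [hsumA.tsum_add hsumB, tsum_mul_left, tsum_mul_left, tsum_mul_left, tsum_mul_left, hS₁]
    _ ≤ Cd ^ 2 * ((25 * T) * S₁) + Cd ^ 2 * (65 * (G * X ^ (2 - 2 * σ₁ + 2 * ε))) := by
        gcongr
        · linarith
        · refine hB.trans ?_
          rw [hG, add_mul, one_mul]
          have hX2 : (X / 2) ^ (α + 1) ≤ X ^ (2 - 2 * σ₁ + 2 * ε) := by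
            rw [show α + 1 = 2 - 2 * σ₁ + 2 * ε by rw [hα]; ring]
            exact Real.rpow_le_rpow (by positivity) (by linarith) (by linarith)
          have hX1 : (1 : ℝ) ≤ X ^ (2 - 2 * σ₁ + 2 * ε) := Real.one_le_rpow hX (by linarith)
          have := Real.Gamma_pos_of_pos (by linarith : 0 < α + 1)
          nlinarith
    _ ≤ Cd ^ 2 * (25 * S₁ + 65 * G) * (T + X ^ (2 - 2 * σ₁ + 2 * ε)) := by
        have h1 : 0 ≤ Cd ^ 2 * (25 * S₁) * X ^ (2 - 2 * σ₁ + 2 * ε) := by positivity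
        have h2 : 0 ≤ Cd ^ 2 * (65 * G) * T := by positivity
        nlinarith [h1, h2]

/-! ### A pointwise bound on the lines `−1/2 ≤ Re ≤ 1/2` and the mean-square transfer -/

/-- `‖Z_a(σ' + iu)‖ ≤ 2|d_K| e^{2n_K} (3 + |u|)^{n_K+1}` for `−1/2 ≤ σ' ≤ 1/2`, `|a| ≤ 1`.
[cite: Rademacher1959, Thm. 4] -/
theorem norm_classTwistedZeta_line_le {a : ClassGroup (𝓞 K) → ℂ} (ha : ∀ C, ‖a C‖ ≤ 1)
    {σ' : ℝ} (h1 : -1 / 2 ≤ σ') (h2 : σ' ≤ 1 / 2) (u : ℝ) :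
    ‖classTwistedZeta K a (σ' + u * I)‖ ≤ 2 * ((NumberField.discr K).natAbs : ℝ) *
      Real.exp (2 * Module.finrank ℚ K) * (3 + |u|) ^ (Module.finrank ℚ K + 1) := by
  set z : ℂ := σ' + u * I with hz
  have hzre : z.re = σ' := by simp [hz]
  have hz1 : z ≠ 1 := fun h ↦ by
    have := congrArg Complex.re h; rw [hzre, Complex.one_re] at this; linarith
  have hZle := norm_classTwistedZeta_le_of_re_ge (K := K) ha (z := z) (by rw [hzre]; exact h1) hz1
  have hzm1 : 1 / 2 ≤ ‖z - 1‖ := by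
    have := Complex.abs_re_le_norm (z - 1)
    rw [Complex.sub_re, hzre, Complex.one_re] at this
    have h' : 1 / 2 ≤ |σ' - 1| := by rw [abs_of_neg (by linarith)]; linarith
    linarith
  have hz52 : ‖z + 5 / 2‖ ≤ 3 + |u| := by
    calc ‖z + 5 / 2‖ = ‖((σ' + 5 / 2 : ℝ) : ℂ) + (u : ℂ) * I‖ := by rw [hz]; congr 1; push_cast; ring
      _ ≤ ‖((σ' + 5 / 2 : ℝ) : ℂ)‖ + ‖(u : ℂ) * I‖ := norm_add_le _ _
      _ ≤ 3 + |u| := by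
          gcongr
          · rw [Complex.norm_real, Real.norm_eq_abs, abs_of_pos (by linarith)]; linarith
          · simp
  set A : ℝ := ((NumberField.discr K).natAbs : ℝ) * Real.exp (2 * Module.finrank ℚ K) with hA
  calc ‖classTwistedZeta K a z‖ ≤ A * ‖z + 5 / 2‖ ^ (Module.finrank ℚ K + 1) / ‖z - 1‖ := hZle
    _ ≤ A * (3 + |u|) ^ (Module.finrank ℚ K + 1) / (1 / 2) :=
        div_le_div₀ (by positivity) (by gcongr) (by norm_num) hzm1
    _ = 2 * ((NumberField.discr K).natAbs : ℝ) * Real.exp (2 * Module.finrank ℚ K) *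
          (3 + |u|) ^ (Module.finrank ℚ K + 1) := by rw [hA]; ring

/-- A non-integer in `[−1/2, 1/2]` other than `0` does not exist: `σ' ∈ [−1/2, 1/2] ∖ {0}` is not
an integer. [folklore] -/
theorem ne_intCast_of_mem_Icc {σ' : ℝ} (h1 : -1 / 2 ≤ σ') (h2 : σ' ≤ 1 / 2) (h0 : σ' ≠ 0) (n : ℤ) :
    σ' ≠ n := by
  intro h
  rw [h] at h1 h2 h0
  have hn1 : (-1 : ℤ) < n := by
    have : ((-1 : ℤ) : ℝ) < n := by push_cast; linarith
    exact_mod_cast this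
  have hn2 : n < 1 := by
    have : (n : ℝ) < (1 : ℤ) := by push_cast; linarith
    exact_mod_cast this
  have : n = 0 := by omega
  rw [this] at h0; simp at h0

/-- **Mean-square transfer through the functional equation.** Let `K` be imaginary quadratic,
`−1/2 ≤ σ' ≤ 1/2`, `σ' ≠ 0`. If `∫_{−U}^{U} |Z_b(1 − σ' + iu)|² du ≤ C₁ U` for all `|b| ≤ 1` and
`U ≥ 1`, then `∫_{−U}^{U} |Z_b(σ' + iu)|² du ≤ C₂ U^{3 − 4σ'}` for all `|b| ≤ 1` and `U ≥ 1`.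
[cite: NeukirchANT1999, Ch. VII (8.6) (functional equation), consequence] -/
theorem meanSquare_transfer (h2 : Module.finrank ℚ K = 2) (hd : NumberField.discr K < 0)
    {σ' : ℝ} (hσ'1 : -1 / 2 ≤ σ') (hσ'2 : σ' ≤ 1 / 2) (hσ'0 : σ' ≠ 0) {C₁ : ℝ}
    (hC₁ : ∀ b : ClassGroup (𝓞 K) → ℂ, (∀ C, ‖b C‖ ≤ 1) → ∀ U : ℝ, 1 ≤ U →
      ∫ u in (-U)..U, ‖classTwistedZeta K b ((1 - σ' : ℝ) + u * I)‖ ^ 2 ≤ C₁ * U) :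
    ∃ C₂ : ℝ, 0 < C₂ ∧ ∀ b : ClassGroup (𝓞 K) → ℂ, (∀ C, ‖b C‖ ≤ 1) → ∀ U : ℝ, 1 ≤ U →
      ∫ u in (-U)..U, ‖classTwistedZeta K b (σ' + u * I)‖ ^ 2 ≤ C₂ * U ^ (3 - 4 * σ') := by
  obtain ⟨σp, CF, hCF, hFE⟩ := exists_norm_classTwistedZeta_le_of_discr_neg (K := K) h2 hd
  set C₁' : ℝ := max C₁ 1 with hC₁'
  have hC₁'0 : 0 < C₁' := lt_of_lt_of_le one_pos (le_max_right _ _)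
  refine ⟨CF ^ 2 * (2 : ℝ) ^ (2 - 4 * σ') * C₁', by positivity, fun b hb U hU ↦ ?_⟩
  have hU0 : 0 < U := by linarith
  have hbσ : ∀ C, ‖(b ∘ σp) C‖ ≤ 1 := fun C ↦ hb (σp C)
  have hint : ∀ s : ℝ, ∫ u in (-U)..U, ‖classTwistedZeta K (b ∘ σp) ((1 - σ' : ℝ) + u * I)‖ ^ 2 ≤
      C₁' * U := fun s ↦ (hC₁ (b ∘ σp) hbσ U hU).trans (by gcongr; exact le_max_left _ _)
  -- pointwise bound on `[-U, U]`
  have hpt : ∀ u ∈ Icc (-U) U, ‖classTwistedZeta K b (σ' + u * I)‖ ^ 2 ≤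
      CF ^ 2 * (1 + U) ^ (2 - 4 * σ') *
        ‖classTwistedZeta K (b ∘ σp) ((1 - σ' : ℝ) + (-u) * I)‖ ^ 2 := by
    intro u hu
    have hsn : ∀ n : ℤ, (σ' : ℂ) + u * I ≠ n :=
      ClassMeanSquare.ne_int_of_re_ne_int (ne_intCast_of_mem_Icc hσ'1 hσ'2 hσ'0)
    have h := hFE b σ' u hσ'1 hσ'2 hsn
    have h1s : (1 : ℂ) - (σ' + u * I) = ((1 - σ' : ℝ) : ℂ) + (-u : ℝ) * I := by push_cast; ring
    rw [h1s] at h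
    have habs : |u| ≤ U := abs_le.mpr ⟨by linarith [hu.1], hu.2⟩
    have hB : (1 + |u|) ^ (1 - 2 * σ') ≤ (1 + U) ^ (1 - 2 * σ') :=
      Real.rpow_le_rpow (by positivity) (by linarith) (by linarith)
    have h0 : 0 ≤ CF * (1 + |u|) ^ (1 - 2 * σ') *
        ‖classTwistedZeta K (b ∘ σp) (((1 - σ' : ℝ) : ℂ) + (-u : ℝ) * I)‖ := by positivity
    calc ‖classTwistedZeta K b (σ' + u * I)‖ ^ 2
        ≤ (CF * (1 + |u|) ^ (1 - 2 * σ') *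
            ‖classTwistedZeta K (b ∘ σp) (((1 - σ' : ℝ) : ℂ) + (-u : ℝ) * I)‖) ^ 2 :=
          pow_le_pow_left₀ (norm_nonneg _) h 2
      _ ≤ (CF * (1 + U) ^ (1 - 2 * σ') *
            ‖classTwistedZeta K (b ∘ σp) (((1 - σ' : ℝ) : ℂ) + (-u : ℝ) * I)‖) ^ 2 := by
          gcongr
      _ = CF ^ 2 * (1 + U) ^ (2 - 4 * σ') *
            ‖classTwistedZeta K (b ∘ σp) ((1 - σ' : ℝ) + (-u) * I)‖ ^ 2 := by
          rw [mul_pow, mul_pow, ← Real.rpow_natCast ((1 + U) ^ _) 2, ← Real.rpow_mul (by positivity)]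
          congr 2
          · norm_num; ring
          · push_cast; ring_nf
  -- continuity (integrability) of both sides
  have hcont1 : Continuous fun u : ℝ ↦ ‖classTwistedZeta K b (σ' + u * I)‖ ^ 2 :=
    ((continuous_classTwistedZeta_vertical (K := K) b (z₀ := σ') (by simp; linarith)).norm).pow 2
  have hcont2 : Continuous fun u : ℝ ↦
      ‖classTwistedZeta K (b ∘ σp) ((1 - σ' : ℝ) + u * I)‖ ^ 2 :=
    ((continuous_classTwistedZeta_vertical (K := K) (b ∘ σp) (z₀ := ((1 - σ' : ℝ) : ℂ))
      (by simp; exact hσ'0)).norm).pow 2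
  have hcont3 : Continuous fun u : ℝ ↦ CF ^ 2 * (1 + U) ^ (2 - 4 * σ') *
      ‖classTwistedZeta K (b ∘ σp) ((1 - σ' : ℝ) + (-u) * I)‖ ^ 2 := by
    refine continuous_const.mul ?_
    have := hcont2.comp continuous_neg
    refine this.congr fun u ↦ ?_
    simp only [Function.comp_apply]
    push_cast; ring_nf
  have hle := intervalIntegral.integral_mono_on (by linarith : -U ≤ U)
    (hcont1.intervalIntegrable (μ := volume) (-U) U) (hcont3.intervalIntegrable (μ := volume) (-U) U)
    hpt
  refine hle.trans ?_
  rw [intervalIntegral.integral_const_mul]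
  have hneg : ∫ u in (-U)..U, ‖classTwistedZeta K (b ∘ σp) ((1 - σ' : ℝ) + (-u) * I)‖ ^ 2 =
      ∫ u in (-U)..U, ‖classTwistedZeta K (b ∘ σp) ((1 - σ' : ℝ) + u * I)‖ ^ 2 := by
    have h := intervalIntegral.integral_comp_neg (a := -U) (b := U)
      (f := fun u : ℝ ↦ ‖classTwistedZeta K (b ∘ σp) ((1 - σ' : ℝ) + u * I)‖ ^ 2)
    rw [neg_neg] at h
    refine Eq.trans (intervalIntegral.integral_congr fun u _ ↦ ?_) h
    push_cast; ring_nf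
  rw [hneg]
  have h1U : (1 + U) ^ (2 - 4 * σ') ≤ (2 : ℝ) ^ (2 - 4 * σ') * U ^ (2 - 4 * σ') := by
    rw [← Real.mul_rpow (by norm_num) hU0.le]
    exact Real.rpow_le_rpow (by positivity) (by linarith) (by linarith)
  have hI0 : 0 ≤ ∫ u in (-U)..U, ‖classTwistedZeta K (b ∘ σp) ((1 - σ' : ℝ) + u * I)‖ ^ 2 :=
    intervalIntegral.integral_nonneg (by linarith) fun u _ ↦ by positivity
  calc CF ^ 2 * (1 + U) ^ (2 - 4 * σ') *
        ∫ u in (-U)..U, ‖classTwistedZeta K (b ∘ σp) ((1 - σ' : ℝ) + u * I)‖ ^ 2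
      ≤ CF ^ 2 * ((2 : ℝ) ^ (2 - 4 * σ') * U ^ (2 - 4 * σ')) * (C₁' * U) := by
        gcongr
        exact hint 0
    _ = CF ^ 2 * (2 : ℝ) ^ (2 - 4 * σ') * C₁' * (U ^ (2 - 4 * σ') * U) := by ring
    _ = CF ^ 2 * (2 : ℝ) ^ (2 - 4 * σ') * C₁' * U ^ (3 - 4 * σ') := by
        rw [← Real.rpow_add_one hU0.ne']; congr 2; ring

/-! ### Mean square of the shifted-line remainder (Cauchy–Schwarz and Fubini) -/

set_option maxHeartbeats 800000 in
/-- **Mean square of the remainder integral**, uniformly in the shift `a' ∈ [a₁, a₂] ⊂ (0, 1)` and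
in the coefficients `|a| ≤ 1`. Let `−1/2 ≤ σ' ≤ 1/2` and suppose
`∫_{−U}^{U} |Z_b(σ' + iu)|² du ≤ C₂ U^q` for all `|b| ≤ 1`, `U ≥ 1` (`q ≥ 0`). Then for `|a| ≤ 1`,
`a₁ ≤ a' ≤ a₂`, `X > 0`, `T ≥ 1`, with `s = σ' + a' + it`,
`∫_{−T}^{T} |(1/2π) ∫ Z_a(s − a' + iy) Γ(−a'+iy) X^{−a'+iy} dy|² dt ≤ C₃ X^{−2a'} T^q`:
pointwise `|(1/2π)∫…|² ≤ (X^{−2a'}/4π²) (∫|Γ|)(∫ |Γ(−a'+iy)| |Z_a(σ'+i(t+y))|² dy)` (Cauchy–Schwarz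
with the weight `|Γ(−a'+iy)| ≤ C(1+|y|)^{3/2}e^{−π|y|/2}`), then Fubini and
`∫_{−T}^{T}|Z_a(σ'+i(t+y))|²dt ≤ C₂ (T+|y|)^q`. [folklore] -/
theorem meanSquare_remainder_le {σ' a₁ a₂ : ℝ} (hσ'1 : -1 / 2 ≤ σ') (hσ'2 : σ' ≤ 1 / 2)
    (ha₁ : 0 < a₁) (ha₁₂ : a₁ ≤ a₂) (ha₂ : a₂ < 1) {C₂ q : ℝ} (hq : 0 ≤ q)
    (hM : ∀ b : ClassGroup (𝓞 K) → ℂ, (∀ C, ‖b C‖ ≤ 1) → ∀ U : ℝ, 1 ≤ U →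
      ∫ u in (-U)..U, ‖classTwistedZeta K b (σ' + u * I)‖ ^ 2 ≤ C₂ * U ^ q) :
    ∃ C₃ : ℝ, 0 < C₃ ∧ ∀ a : ClassGroup (𝓞 K) → ℂ, (∀ C, ‖a C‖ ≤ 1) →
      ∀ (a' X T : ℝ), a₁ ≤ a' → a' ≤ a₂ → 0 < X → 1 ≤ T →
      ∫ t in (-T)..T, ‖(1 / (2 * π) : ℂ) * ∫ y : ℝ,
        classTwistedZeta K a (((σ' + a' : ℝ) : ℂ) + t * I + ((-a' : ℝ) + y * I)) *
          Complex.Gamma ((-a' : ℝ) + y * I) * (X : ℂ) ^ (((-a' : ℝ) : ℂ) + y * I)‖ ^ 2 ≤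
        C₃ * X ^ (-(2 * a')) * T ^ q := by
  set m : ℕ := Module.finrank ℚ K + 1 with hm
  set A : ℝ := 2 * ((NumberField.discr K).natAbs : ℝ) * Real.exp (2 * Module.finrank ℚ K) with hA
  have hA0 : 0 ≤ A := by positivity
  -- the uniform majorant of the weights `|Γ(-a' + iy)|`, `a₁ ≤ a' ≤ a₂`
  set Cu : ℝ := 16 * π ^ 2 + Real.exp (π / 2) / (a₁ * (1 - a₂)) with hCu
  have hCu0 : 0 ≤ Cu := by
    have : 0 < 1 - a₂ := by linarith
    rw [hCu]; positivity
  set ω : ℝ → ℝ := fun y ↦ Cu * (1 + |y|) ^ (3 / 2 : ℝ) * Real.exp (-(π * |y|) / 2) with hω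
  have hω0 : ∀ y, 0 ≤ ω y := fun y ↦ by positivity
  have hωcont : Continuous ω := by
    refine (continuous_const.mul (Continuous.rpow_const (by fun_prop)
      fun y ↦ Or.inl (by positivity))).mul (by fun_prop)
  have hpi : 0 < π / 2 := by positivity
  have he : ∀ y : ℝ, Real.exp (-(π * |y|) / 2) = Real.exp (-(π / 2 * |y|)) := fun y ↦ by
    congr 1; ring
  -- `ω (1+|y|)^r` is integrable for every `r ≥ 0`
  have hωr : ∀ r : ℝ, 0 ≤ r → Integrable fun y ↦ ω y * (1 + |y|) ^ r := by
    intro r hr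
    have hdom := (Literature.Analysis.SpecialFunctions.integrable_one_add_abs_rpow_mul_exp_neg hpi
      (p := r + 3 / 2) (by positivity)).const_mul Cu
    refine hdom.congr (Eventually.of_forall fun y ↦ ?_)
    simp only [hω]
    rw [he, Real.rpow_add (by positivity)]; ring
  set G₁ : ℝ := ∫ y, ω y with hG₁
  set Gq : ℝ := ∫ y, ω y * (1 + |y|) ^ q with hGq
  have hG₁0 : 0 ≤ G₁ := integral_nonneg hω0
  have hGq0 : 0 ≤ Gq := integral_nonneg fun y ↦ by positivity
  set C₂' : ℝ := max C₂ 0 with hC₂'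
  have hC₂'0 : 0 ≤ C₂' := le_max_right _ _
  refine ⟨G₁ / (4 * π ^ 2) * C₂' * Gq + 1, by positivity, fun a ha a' X T ha'1 ha'2 hX hT ↦ ?_⟩
  have ha'0 : 0 < a' := by linarith
  have ha'3 : a' < 1 := by linarith
  set Z : ℂ → ℂ := classTwistedZeta K a with hZ_def
  -- the weight `ρ = |Γ(-a' + iy)| ≤ ω`
  set ρ : ℝ → ℝ := fun y ↦ ‖Complex.Gamma ((-a' : ℝ) + y * I)‖ with hρ
  have hρ0 : ∀ y, 0 ≤ ρ y := fun y ↦ norm_nonneg _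
  have hρle : ∀ y, ρ y ≤ ω y := fun y ↦
    (ClassMeanSquare.norm_Gamma_neg_line_le ha'0 ha'3 y).trans (by
      simp only [hω]
      gcongr
      exact ClassMeanSquare.gammaLineConst_mono ha₁ ha₂ ha'1 ha'2)
  have hρcont : Continuous ρ :=
    (ClassMeanSquare.continuous_Gamma_neg_line (x := -a') (by linarith : (-a' : ℝ) < 0).ne
      (by linarith)).norm
  have hρr : ∀ r : ℝ, 0 ≤ r → Integrable fun y ↦ ρ y * (1 + |y|) ^ r := by
    intro r hr
    refine (hωr r hr).mono' ((hρcont.mul (Continuous.rpow_const (by fun_prop)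
      fun y ↦ Or.inl (by positivity))).aestronglyMeasurable) (Eventually.of_forall fun y ↦ ?_)
    rw [Real.norm_eq_abs, abs_of_nonneg (by positivity)]
    exact mul_le_mul_of_nonneg_right (hρle y) (by positivity)
  have hρint : Integrable ρ := by
    have := hρr 0 le_rfl
    simpa [Real.rpow_zero] using this
  have hρG₁ : ∫ y, ρ y ≤ G₁ := by
    rw [hG₁]
    refine integral_mono hρint ?_ hρle
    have := hωr 0 le_rfl
    simpa [Real.rpow_zero] using this
  -- the shifted values of `Z_a`
  set f₀ : ℝ → ℝ := fun u ↦ ‖Z (σ' + u * I)‖ with hf₀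
  have hf₀le : ∀ u, f₀ u ≤ A * (3 + |u|) ^ m := fun u ↦ norm_classTwistedZeta_line_le ha hσ'1 hσ'2 u
  have hf₀cont : Continuous f₀ :=
    (continuous_classTwistedZeta_vertical (K := K) a (z₀ := σ') (by simp; linarith)).norm
  set g : ℝ → ℝ → ℝ := fun t y ↦ f₀ (t + y) with hg
  have hg0 : ∀ t y, 0 ≤ g t y := fun t y ↦ norm_nonneg _
  have hgle : ∀ t y, g t y ≤ A * (3 + |t|) ^ m * (1 + |y|) ^ m := by
    intro t y
    calc g t y ≤ A * (3 + |t + y|) ^ m := hf₀le (t + y)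
      _ ≤ A * ((3 + |t|) * (1 + |y|)) ^ m := by
          gcongr
          nlinarith [abs_add_le t y, abs_nonneg t, abs_nonneg y]
      _ = A * (3 + |t|) ^ m * (1 + |y|) ^ m := by rw [mul_pow]; ring
  have hgcont2 : Continuous fun p : ℝ × ℝ ↦ g p.1 p.2 := hf₀cont.comp (by fun_prop)
  have hgcont : ∀ t, Continuous (g t) := fun t ↦ hf₀cont.comp (by fun_prop)
  -- integrability in `y` of `ρ g_t` and `ρ g_t²`
  have hint1 : ∀ t, Integrable fun y ↦ ρ y * g t y := by
    intro t
    have hdom := (hρr m (Nat.cast_nonneg m)).const_mul (A * (3 + |t|) ^ m)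
    refine hdom.mono' ((hρcont.mul (hgcont t)).aestronglyMeasurable) (Eventually.of_forall fun y ↦ ?_)
    rw [Real.norm_eq_abs, abs_of_nonneg (mul_nonneg (hρ0 y) (hg0 t y))]
    calc ρ y * g t y ≤ ρ y * (A * (3 + |t|) ^ m * (1 + |y|) ^ m) := by gcongr; exact hgle t y
      _ = A * (3 + |t|) ^ m * (ρ y * (1 + |y|) ^ (m : ℝ)) := by rw [Real.rpow_natCast]; ring
  have hint2 : ∀ t, Integrable fun y ↦ ρ y * g t y ^ 2 := by
    intro t
    have hdom := (hρr ((2 * m : ℕ) : ℝ) (Nat.cast_nonneg _)).const_mul ((A * (3 + |t|) ^ m) ^ 2)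
    refine hdom.mono' ((hρcont.mul ((hgcont t).pow 2)).aestronglyMeasurable)
      (Eventually.of_forall fun y ↦ ?_)
    rw [Real.norm_eq_abs, abs_of_nonneg (mul_nonneg (hρ0 y) (sq_nonneg _))]
    calc ρ y * g t y ^ 2 ≤ ρ y * (A * (3 + |t|) ^ m * (1 + |y|) ^ m) ^ 2 := by
          gcongr; exact hgle t y
      _ = (A * (3 + |t|) ^ m) ^ 2 * (ρ y * (1 + |y|) ^ ((2 * m : ℕ) : ℝ)) := by
          rw [Real.rpow_natCast, pow_mul']; ring
  -- ### Step 1: the pointwise Cauchy–Schwarz bound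
  have hpt : ∀ t : ℝ,
      ‖(1 / (2 * π) : ℂ) * ∫ y : ℝ, Z (((σ' + a' : ℝ) : ℂ) + t * I + ((-a' : ℝ) + y * I)) *
          Complex.Gamma ((-a' : ℝ) + y * I) * (X : ℂ) ^ (((-a' : ℝ) : ℂ) + y * I)‖ ^ 2 ≤
        G₁ / (4 * π ^ 2) * X ^ (-(2 * a')) * ∫ y, ρ y * g t y ^ 2 := by
    intro t
    set Φ : ℝ → ℂ := fun y ↦ Z (((σ' + a' : ℝ) : ℂ) + t * I + ((-a' : ℝ) + y * I)) *
      Complex.Gamma ((-a' : ℝ) + y * I) * (X : ℂ) ^ (((-a' : ℝ) : ℂ) + y * I) with hΦ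
    have hnormΦ : ∀ y, ‖Φ y‖ = ρ y * g t y * X ^ (-a') := by
      intro y
      simp only [hΦ, norm_mul, hρ, hg, hf₀]
      rw [Complex.norm_cpow_eq_rpow_re_of_pos hX]
      simp only [add_re, ofReal_re, mul_re, I_re, mul_zero, ofReal_im, I_im, mul_one, sub_self,
        add_zero]
      have : ((σ' + a' : ℝ) : ℂ) + t * I + ((-a' : ℝ) + y * I) = (σ' : ℂ) + ((t + y : ℝ) : ℂ) * I := by
        push_cast; ring
      rw [this]; ring
    have h1 : ‖(1 / (2 * π) : ℂ) * ∫ y, Φ y‖ ≤ 1 / (2 * π) * (X ^ (-a') * ∫ y, ρ y * g t y) := by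
      rw [norm_mul, show ‖(1 / (2 * π) : ℂ)‖ = 1 / (2 * π) by
        rw [show (1 / (2 * π) : ℂ) = ((1 / (2 * π) : ℝ) : ℂ) by push_cast; ring, Complex.norm_real,
          Real.norm_eq_abs, abs_of_pos (by positivity)]]
      refine mul_le_mul_of_nonneg_left ?_ (by positivity)
      calc ‖∫ y, Φ y‖ ≤ ∫ y, ‖Φ y‖ := norm_integral_le_integral_norm _
        _ = ∫ y, (ρ y * g t y) * X ^ (-a') := integral_congr_ae (Eventually.of_forall hnormΦ)
        _ = X ^ (-a') * ∫ y, ρ y * g t y := by rw [integral_mul_const]; ring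
    have hCS := ClassMeanSquare.integral_mul_sq_le hρ0 (hg0 t) hρint (hint1 t) (hint2 t)
    have h0 : 0 ≤ 1 / (2 * π) * (X ^ (-a') * ∫ y, ρ y * g t y) := by
      have : 0 ≤ ∫ y, ρ y * g t y := integral_nonneg fun y ↦ mul_nonneg (hρ0 y) (hg0 t y)
      positivity
    have hI2 : 0 ≤ ∫ y, ρ y * g t y ^ 2 := integral_nonneg fun y ↦ mul_nonneg (hρ0 y) (sq_nonneg _)
    calc ‖(1 / (2 * π) : ℂ) * ∫ y, Φ y‖ ^ 2 ≤ (1 / (2 * π) * (X ^ (-a') * ∫ y, ρ y * g t y)) ^ 2 :=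
          pow_le_pow_left₀ (norm_nonneg _) h1 2
      _ = 1 / (4 * π ^ 2) * X ^ (-(2 * a')) * (∫ y, ρ y * g t y) ^ 2 := by
          have e1 : (X ^ (-a')) ^ 2 = X ^ (-(2 * a')) := by
            rw [← Real.rpow_natCast, ← Real.rpow_mul hX.le]; congr 1; push_cast; ring
          rw [mul_pow, mul_pow, e1]; ring
      _ ≤ 1 / (4 * π ^ 2) * X ^ (-(2 * a')) * ((∫ y, ρ y) * ∫ y, ρ y * g t y ^ 2) := by gcongr
      _ ≤ 1 / (4 * π ^ 2) * X ^ (-(2 * a')) * (G₁ * ∫ y, ρ y * g t y ^ 2) := by gcongr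
      _ = _ := by ring
  -- ### Step 2: Fubini and the mean square on the line `σ'`
  have hinner : ∀ y : ℝ, ∫ t in (-T)..T, g t y ^ 2 ≤ C₂' * T ^ q * (1 + |y|) ^ q := by
    intro y
    have hT0 : 0 < T := by linarith
    have hshift : ∫ t in (-T)..T, g t y ^ 2 = ∫ u in (-T + y)..(T + y), f₀ u ^ 2 :=
      intervalIntegral.integral_comp_add_right (fun u ↦ f₀ u ^ 2) y
    rw [hshift]
    have hU1 : 1 ≤ T + |y| := by linarith [abs_nonneg y]
    have hmono : ∫ u in (-T + y)..(T + y), f₀ u ^ 2 ≤ ∫ u in (-(T + |y|))..(T + |y|), f₀ u ^ 2 := by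
      refine intervalIntegral.integral_mono_interval (by linarith [neg_abs_le y]) (by linarith)
        (by linarith [le_abs_self y]) (Eventually.of_forall fun u ↦ sq_nonneg _) ?_
      exact (hf₀cont.pow 2).intervalIntegrable (μ := volume) _ _
    refine hmono.trans ((hM a ha (T + |y|) hU1).trans ?_)
    have hTy : (T + |y|) ^ q ≤ T ^ q * (1 + |y|) ^ q := by
      rw [← Real.mul_rpow hT0.le (by positivity)]
      exact Real.rpow_le_rpow (by positivity) (by nlinarith [abs_nonneg y]) hq
    calc C₂ * (T + |y|) ^ q ≤ C₂' * (T + |y|) ^ q := by gcongr; exact le_max_left _ _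
      _ ≤ C₂' * (T ^ q * (1 + |y|) ^ q) := by gcongr
      _ = _ := by ring
  have hTT : -T ≤ T := by linarith
  have hT0 : 0 < T := by linarith
  set μ : Measure ℝ := volume.restrict (Ioc (-T) T) with hμ
  haveI : IsFiniteMeasure μ := by rw [hμ]; infer_instance
  set H : ℝ × ℝ → ℝ := fun p ↦ ρ p.2 * g p.1 p.2 ^ 2 with hH
  have hf : Integrable (fun t : ℝ ↦ (A * (3 + |t|) ^ m) ^ 2) μ := by
    have hc : Continuous fun t : ℝ ↦ (A * (3 + |t|) ^ m) ^ 2 := by fun_prop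
    exact (hc.integrableOn_Icc (a := -T) (b := T)).mono_set Ioc_subset_Icc_self
  have hh : Integrable (fun y : ℝ ↦ ρ y * (1 + |y|) ^ ((2 * m : ℕ) : ℝ)) volume :=
    hρr _ (Nat.cast_nonneg _)
  have hHint : Integrable H (μ.prod volume) := by
    refine (hf.mul_prod hh).mono' ?_ (Eventually.of_forall fun p ↦ ?_)
    · exact (hρcont.comp continuous_snd).mul (hgcont2.pow 2) |>.aestronglyMeasurable
    · rw [Real.norm_eq_abs, abs_of_nonneg (mul_nonneg (hρ0 _) (sq_nonneg _))]
      calc ρ p.2 * g p.1 p.2 ^ 2 ≤ ρ p.2 * (A * (3 + |p.1|) ^ m * (1 + |p.2|) ^ m) ^ 2 := by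
            gcongr; exact hgle p.1 p.2
        _ = (A * (3 + |p.1|) ^ m) ^ 2 * (ρ p.2 * (1 + |p.2|) ^ ((2 * m : ℕ) : ℝ)) := by
            rw [Real.rpow_natCast, pow_mul']; ring
  have hleft : Integrable (fun t ↦ ∫ y, H (t, y)) μ := hHint.integral_prod_left
  have hII : IntervalIntegrable (fun t ↦ ∫ y, ρ y * g t y ^ 2) volume (-T) T := by
    rw [intervalIntegrable_iff_integrableOn_Ioc_of_le hTT]
    exact hleft
  have hIle : ∫ t in (-T)..T, (∫ y, ρ y * g t y ^ 2) ≤ C₂' * Gq * T ^ q := by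
    rw [intervalIntegral.integral_of_le hTT]
    have hswap : ∫ t in Ioc (-T) T, (∫ y, ρ y * g t y ^ 2) = ∫ y, ∫ t, H (t, y) ∂μ := by
      rw [← hμ]
      exact MeasureTheory.integral_integral_swap (f := fun t y ↦ H (t, y)) hHint
    rw [hswap]
    have hinner' : ∀ y, ∫ t, H (t, y) ∂μ ≤ ω y * (C₂' * T ^ q * (1 + |y|) ^ q) := by
      intro y
      simp only [hH, hμ]
      rw [integral_const_mul, ← intervalIntegral.integral_of_le hTT]
      exact mul_le_mul (hρle y) (hinner y)
        (intervalIntegral.integral_nonneg hTT fun u _ ↦ sq_nonneg _) (hω0 y)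
    have hnn : ∀ y, 0 ≤ ∫ t, H (t, y) ∂μ := fun y ↦
      integral_nonneg fun t ↦ mul_nonneg (hρ0 _) (sq_nonneg _)
    calc ∫ y, ∫ t, H (t, y) ∂μ ≤ ∫ y, ω y * (C₂' * T ^ q * (1 + |y|) ^ q) :=
          integral_mono_of_nonneg (Eventually.of_forall hnn)
            (((hωr q hq).const_mul (C₂' * T ^ q)).congr (Eventually.of_forall fun y ↦ by
              ring))
            (Eventually.of_forall hinner')
      _ = C₂' * T ^ q * ∫ y, ω y * (1 + |y|) ^ q := by
          rw [← integral_const_mul]; congr 1; funext y; ring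
      _ = C₂' * Gq * T ^ q := by rw [hGq]; ring
  -- ### conclusion
  set R : ℝ → ℝ := fun t ↦ ‖(1 / (2 * π) : ℂ) * ∫ y : ℝ,
      Z (((σ' + a' : ℝ) : ℂ) + t * I + ((-a' : ℝ) + y * I)) *
        Complex.Gamma ((-a' : ℝ) + y * I) * (X : ℂ) ^ (((-a' : ℝ) : ℂ) + y * I)‖ ^ 2 with hR
  have hbound : ∫ t in (-T)..T, G₁ / (4 * π ^ 2) * X ^ (-(2 * a')) * ∫ y, ρ y * g t y ^ 2 ≤
      (G₁ / (4 * π ^ 2) * C₂' * Gq + 1) * X ^ (-(2 * a')) * T ^ q := by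
    rw [intervalIntegral.integral_const_mul]
    have hX2 : 0 ≤ X ^ (-(2 * a')) := Real.rpow_nonneg hX.le _
    calc G₁ / (4 * π ^ 2) * X ^ (-(2 * a')) * ∫ t in (-T)..T, ∫ y, ρ y * g t y ^ 2
        ≤ G₁ / (4 * π ^ 2) * X ^ (-(2 * a')) * (C₂' * Gq * T ^ q) := by gcongr
      _ = (G₁ / (4 * π ^ 2) * C₂' * Gq) * X ^ (-(2 * a')) * T ^ q := by ring
      _ ≤ _ := by gcongr; linarith
  by_cases hRi : IntervalIntegrable R volume (-T) T
  · calc ∫ t in (-T)..T, R t ≤ ∫ t in (-T)..T, G₁ / (4 * π ^ 2) * X ^ (-(2 * a')) *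
          ∫ y, ρ y * g t y ^ 2 :=
          intervalIntegral.integral_mono_on hTT hRi (hII.const_mul _) fun t _ ↦ hpt t
      _ ≤ _ := hbound
  · rw [intervalIntegral.integral_undef hRi]
    have : 0 ≤ (G₁ / (4 * π ^ 2) * C₂' * Gq + 1) * X ^ (-(2 * a')) * T ^ q := by positivity
    exact this

/-! ### The recursive step: from a dual line to a strip -/

/-- The line `Re = σ''` with `σ'' > 1`: `∫_{−U}^{U} |Z_b(σ'' + iu)|² du ≤ 2 e^{2n_K/(σ''−1)} U`.
[folklore] -/
theorem meanSquare_line_of_one_lt {σ'' : ℝ} (hσ'' : 1 < σ'') :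
    ∃ C₁ : ℝ, 0 < C₁ ∧ ∀ b : ClassGroup (𝓞 K) → ℂ, (∀ C, ‖b C‖ ≤ 1) → ∀ U : ℝ, 1 ≤ U →
      ∫ u in (-U)..U, ‖classTwistedZeta K b (σ'' + u * I)‖ ^ 2 ≤ C₁ * U := by
  set B : ℝ := Real.exp (Module.finrank ℚ K / (σ'' - 1)) with hB
  refine ⟨2 * B ^ 2, by positivity, fun b hb U hU ↦ ?_⟩
  have hpt : ∀ u ∈ Icc (-U) U, ‖classTwistedZeta K b (σ'' + u * I)‖ ^ 2 ≤ B ^ 2 := by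
    intro u _
    have h := norm_classTwistedZeta_le_exp (K := K) hb (s := σ'' + u * I) (by simp; linarith)
    simp only [add_re, ofReal_re, mul_re, I_re, mul_zero, ofReal_im, I_im, mul_one, sub_self,
      add_zero] at h
    exact pow_le_pow_left₀ (norm_nonneg _) h 2
  have hcont : Continuous fun u : ℝ ↦ ‖classTwistedZeta K b (σ'' + u * I)‖ ^ 2 :=
    ((continuous_classTwistedZeta_vertical (K := K) b (z₀ := σ'') (by simp; linarith)).norm).pow 2
  calc ∫ u in (-U)..U, ‖classTwistedZeta K b (σ'' + u * I)‖ ^ 2 ≤ ∫ u in (-U)..U, B ^ 2 :=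
        intervalIntegral.integral_mono_on (by linarith) (hcont.intervalIntegrable (μ := volume) _ _)
          intervalIntegrable_const hpt
    _ = 2 * B ^ 2 * U := by rw [intervalIntegral.integral_const]; simp; ring

/-! ### The smoothed sum and the `Γ`-term: continuity and the mean square of the `Γ`-term -/

/-- The smoothed Dirichlet series `t ↦ Σ_n c_a(n) n^{−σ−it} e^{−n/X}` is continuous (`σ ≥ 0`,
`X > 0`; uniformly convergent). [folklore] -/
theorem continuous_smoothedSum {a : ClassGroup (𝓞 K) → ℂ} (ha : ∀ C, ‖a C‖ ≤ 1) {σ : ℝ}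
    (hσ : 0 ≤ σ) {X : ℝ} (hX : 0 < X) :
    Continuous fun t : ℝ ↦ ∑' n : ℕ, classCoeff K a n * (n : ℂ) ^ (-((σ : ℂ) + t * I)) *
      (Real.exp (-(n / X)) : ℂ) := by
  obtain ⟨Cd, hCd1, hCd⟩ := exists_idealNormCount_le_rpow (K := K) one_pos
  have hsum : Summable fun n : ℕ ↦ Cd * ((n : ℝ) ^ (1 : ℕ) * Real.exp (-(1 / X) * n)) :=
    (Real.summable_pow_mul_exp_neg_nat_mul 1 (by positivity)).mul_left Cd
  refine continuous_tsum (fun n ↦ ?_) hsum (fun n t ↦ ?_)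
  · rcases eq_or_ne n 0 with rfl | hn
    · simp only [classCoeff_zero, zero_mul]; exact continuous_const
    · have hn' : (n : ℂ) ≠ 0 := by exact_mod_cast hn
      exact (continuous_const.mul (Continuous.const_cpow (by fun_prop) (Or.inl hn'))).mul
        continuous_const
  · rcases eq_or_ne n 0 with rfl | hn
    · simp [classCoeff_zero]
    · have hnpos : 0 < (n : ℝ) := by exact_mod_cast Nat.pos_of_ne_zero hn
      have hn1 : (1 : ℝ) ≤ n := by exact_mod_cast Nat.pos_of_ne_zero hn
      rw [norm_mul, norm_mul, Complex.norm_natCast_cpow_of_pos (Nat.pos_of_ne_zero hn),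
        Complex.norm_real, Real.norm_eq_abs, abs_of_pos (Real.exp_pos _)]
      simp only [neg_re, add_re, ofReal_re, mul_re, I_re, mul_zero, ofReal_im, I_im, mul_one,
        sub_self, add_zero]
      have h1 : ‖classCoeff K a n‖ ≤ Cd * (n : ℝ) ^ (1 : ℝ) :=
        (norm_classCoeff_le ha n).trans (hCd n hn)
      rw [Real.rpow_one] at h1
      have h2 : (n : ℝ) ^ (-σ) ≤ 1 := Real.rpow_le_one_of_one_le_of_nonpos hn1 (by linarith)
      have h3 : Real.exp (-(n / X)) = Real.exp (-(1 / X) * n) := by congr 1; field_simp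
      calc ‖classCoeff K a n‖ * (n : ℝ) ^ (-σ) * Real.exp (-(n / X))
          ≤ (Cd * n) * 1 * Real.exp (-(n / X)) := by gcongr
        _ = Cd * ((n : ℝ) ^ (1 : ℕ) * Real.exp (-(1 / X) * n)) := by rw [h3, pow_one]; ring

/-- A masked smoothed Dirichlet series `t ↦ Σ_{n ∈ S} c_a(n) n^{−σ−it} e^{−n/X}` is continuous
(`σ ≥ 0`, `X > 0`; uniformly convergent), for any set `S` of indices. [folklore] -/
theorem continuous_maskedSum {a : ClassGroup (𝓞 K) → ℂ} (ha : ∀ C, ‖a C‖ ≤ 1) (S : Set ℕ)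
    {σ : ℝ} (hσ : 0 ≤ σ) {X : ℝ} (hX : 0 < X) :
    Continuous fun t : ℝ ↦ ∑' n : ℕ, S.indicator (fun n ↦ classCoeff K a n *
      (n : ℂ) ^ (-((σ : ℂ) + t * I)) * (Real.exp (-(n / X)) : ℂ)) n := by
  classical
  obtain ⟨Cd, hCd1, hCd⟩ := exists_idealNormCount_le_rpow (K := K) one_pos
  have hsum : Summable fun n : ℕ ↦ Cd * ((n : ℝ) ^ (1 : ℕ) * Real.exp (-(1 / X) * n)) :=
    (Real.summable_pow_mul_exp_neg_nat_mul 1 (by positivity)).mul_left Cd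
  refine continuous_tsum (fun n ↦ ?_) hsum (fun n t ↦ ?_)
  · by_cases hnS : n ∈ S
    · simp only [Set.indicator_of_mem hnS]
      rcases eq_or_ne n 0 with rfl | hn
      · simp only [classCoeff_zero, zero_mul]; exact continuous_const
      · have hn' : (n : ℂ) ≠ 0 := by exact_mod_cast hn
        exact (continuous_const.mul (Continuous.const_cpow (by fun_prop) (Or.inl hn'))).mul
          continuous_const
    · simp only [Set.indicator_of_notMem hnS]; exact continuous_const
  · have hle : ‖S.indicator (fun n ↦ classCoeff K a n * (n : ℂ) ^ (-((σ : ℂ) + t * I)) *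
        (Real.exp (-(n / X)) : ℂ)) n‖ ≤
        ‖classCoeff K a n * (n : ℂ) ^ (-((σ : ℂ) + t * I)) * (Real.exp (-(n / X)) : ℂ)‖ := by
      rw [norm_indicator_eq_indicator_norm]
      exact Set.indicator_le_self' (fun _ _ ↦ norm_nonneg _) n
    refine hle.trans ?_
    rcases eq_or_ne n 0 with rfl | hn
    · simp [classCoeff_zero]
    · have hnpos : 0 < (n : ℝ) := by exact_mod_cast Nat.pos_of_ne_zero hn
      have hn1 : (1 : ℝ) ≤ n := by exact_mod_cast Nat.pos_of_ne_zero hn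
      rw [norm_mul, norm_mul, Complex.norm_natCast_cpow_of_pos (Nat.pos_of_ne_zero hn),
        Complex.norm_real, Real.norm_eq_abs, abs_of_pos (Real.exp_pos _)]
      simp only [neg_re, add_re, ofReal_re, mul_re, I_re, mul_zero, ofReal_im, I_im, mul_one,
        sub_self, add_zero]
      have h1 : ‖classCoeff K a n‖ ≤ Cd * (n : ℝ) ^ (1 : ℝ) :=
        (norm_classCoeff_le ha n).trans (hCd n hn)
      rw [Real.rpow_one] at h1
      have h2 : (n : ℝ) ^ (-σ) ≤ 1 := Real.rpow_le_one_of_one_le_of_nonpos hn1 (by linarith)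
      have h3 : Real.exp (-(n / X)) = Real.exp (-(1 / X) * n) := by congr 1; field_simp
      calc ‖classCoeff K a n‖ * (n : ℝ) ^ (-σ) * Real.exp (-(n / X))
          ≤ (Cd * n) * 1 * Real.exp (-(n / X)) := by gcongr
        _ = Cd * ((n : ℝ) ^ (1 : ℕ) * Real.exp (-(1 / X) * n)) := by rw [h3, pow_one]; ring

/-- The `Γ`-term `t ↦ Z₁_a(1) Γ(1 − σ − it) X^{1−σ−it}` is continuous (`σ < 1`, `X > 0`). [folklore] -/
theorem continuous_poleTerm (a : ClassGroup (𝓞 K) → ℂ) {σ : ℝ} (hσ : σ < 1) {X : ℝ} (hX : 0 < X) :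
    Continuous fun t : ℝ ↦ classTwistedZeta₁ K a 1 * Complex.Gamma (1 - ((σ : ℂ) + t * I)) *
      (X : ℂ) ^ (1 - ((σ : ℂ) + t * I)) := by
  have hX0' : (X : ℂ) ≠ 0 := by exact_mod_cast hX.ne'
  have hΓ : Continuous fun t : ℝ ↦ Complex.Gamma (1 - ((σ : ℂ) + t * I)) := by
    have h := (ClassMeanSquare.continuous_Gamma_neg_line (x := 1 - σ)
      (by linarith : (1 - σ : ℝ) ≠ 0 |> fun h ↦ h) (by linarith)).comp continuous_neg
    refine h.congr fun t ↦ ?_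
    simp only [Function.comp_apply]
    congr 1; push_cast; ring
  exact (continuous_const.mul hΓ).mul (Continuous.const_cpow (by fun_prop) (Or.inl hX0'))

/-- **Mean square of the `Γ`-term.** For `σ₂ < 1` there is `C_P` with
`∫_{−T}^{T} |Z₁_a(1) Γ(1−σ−it) X^{1−σ−it}|² dt ≤ C_P X^{2−2σ}` for all `|a| ≤ 1`, `1/2 ≤ σ ≤ σ₂`,
`X > 0`, `T > 0` (`|Z₁_a(1)| ≤ |d_K|e^{2n_K}(7/2)^{n_K+1}`, `|Γ(1−σ−it)| ≪ (1+|t|)e^{−π|t|/2}/(1−σ₂)`,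
and `∫(1+|t|)²e^{−π|t|}dt < ∞`). [folklore] -/
theorem exists_meanSquare_poleTerm_le {σ₂ : ℝ} (hσ₂ : σ₂ < 1) :
    ∃ CP : ℝ, 0 < CP ∧ ∀ a : ClassGroup (𝓞 K) → ℂ, (∀ C, ‖a C‖ ≤ 1) →
      ∀ σ : ℝ, 1 / 2 ≤ σ → σ ≤ σ₂ → ∀ X : ℝ, 0 < X → ∀ T : ℝ, 0 < T →
        ∫ t in (-T)..T, ‖classTwistedZeta₁ K a 1 * Complex.Gamma (1 - ((σ : ℂ) + t * I)) *
          (X : ℂ) ^ (1 - ((σ : ℂ) + t * I))‖ ^ 2 ≤ CP * X ^ (2 - 2 * σ) := by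
  obtain ⟨Cg, hCg, hG⟩ := ClassMeanSquare.exists_norm_Gamma_le_strip
  set n₀ : ℕ := Module.finrank ℚ K with hn₀
  set ρ₀ : ℝ := ((NumberField.discr K).natAbs : ℝ) * Real.exp (2 * n₀) *
    ‖(1 : ℂ) + 5 / 2‖ ^ (n₀ + 1) with hρ₀
  have hρ₀0 : 0 ≤ ρ₀ := by positivity
  have hZ1 : ∀ a : ClassGroup (𝓞 K) → ℂ, (∀ C, ‖a C‖ ≤ 1) → ‖classTwistedZeta₁ K a 1‖ ≤ ρ₀ :=
    fun a ha ↦ norm_classTwistedZeta₁_le (K := K) ha (z := 1) (by norm_num)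
  have hIe := Literature.Analysis.SpecialFunctions.integrable_one_add_abs_rpow_mul_exp_neg
    (a := π) Real.pi_pos (p := 2) (by norm_num)
  set Ie : ℝ := ∫ t : ℝ, (1 + |t|) ^ (2 : ℝ) * Real.exp (-(π * |t|)) with hIe_def
  have hIe0 : 0 ≤ Ie := integral_nonneg fun t ↦ by positivity
  have h1σ₂ : 0 < 1 - σ₂ := by linarith
  set M : ℝ := (ρ₀ * Cg / (1 - σ₂)) ^ 2 with hM
  refine ⟨M * Ie + 1, by positivity, fun a ha σ hσ1 hσ2 X hX0 T hT0 ↦ ?_⟩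
  have hTT : -T ≤ T := by linarith
  have hZ1a := hZ1 a ha
  set P : ℝ → ℂ := fun t ↦ classTwistedZeta₁ K a 1 * Complex.Gamma (1 - ((σ : ℂ) + t * I)) *
    (X : ℂ) ^ (1 - ((σ : ℂ) + t * I)) with hP
  have hPc : Continuous P := continuous_poleTerm a (by linarith) hX0
  -- pointwise
  have hPt : ∀ t : ℝ, ‖P t‖ ^ 2 ≤ M * X ^ (2 - 2 * σ) * ((1 + |t|) ^ (2 : ℝ) * Real.exp (-(π * |t|))) := by
    intro t
    set w : ℂ := 1 - ((σ : ℂ) + t * I) with hw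
    have hwre : w.re = 1 - σ := by simp [hw]
    have hw0 : w ≠ 0 := fun h ↦ by
      have := congrArg Complex.re h; rw [hwre] at this; simp at this; linarith
    have hw1 : w + 1 = ((2 - σ : ℝ) : ℂ) + ((-t : ℝ) : ℂ) * I := by rw [hw]; push_cast; ring
    have hΓ1 : ‖Complex.Gamma (w + 1)‖ ≤ Cg * (1 + |t|) * Real.exp (-(π * |t|) / 2) := by
      rw [hw1]
      refine (hG (2 - σ) (-t) (by linarith) (by linarith)).trans ?_
      rw [abs_neg]
      gcongr
      calc (1 + |t|) ^ (2 - σ - 1 / 2) ≤ (1 + |t|) ^ (1 : ℝ) :=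
            Real.rpow_le_rpow_of_exponent_le (by linarith [abs_nonneg t]) (by linarith)
        _ = 1 + |t| := Real.rpow_one _
    have hΓw : ‖Complex.Gamma w‖ ≤ Cg * (1 + |t|) * Real.exp (-(π * |t|) / 2) / (1 - σ₂) := by
      have hrec : Complex.Gamma w = Complex.Gamma (w + 1) / w := by
        rw [Complex.Gamma_add_one w hw0]; field_simp
      have hden : 1 - σ₂ ≤ ‖w‖ := by
        have := Complex.abs_re_le_norm w
        rw [hwre, abs_of_pos (by linarith)] at this; linarith
      rw [hrec, norm_div]
      exact div_le_div₀ (by positivity) hΓ1 h1σ₂ hden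
    have hXn : ‖(X : ℂ) ^ (1 - ((σ : ℂ) + t * I))‖ = X ^ (1 - σ) := by
      rw [Complex.norm_cpow_eq_rpow_re_of_pos hX0]; simp
    have hPn : ‖P t‖ ≤ ρ₀ * (Cg * (1 + |t|) * Real.exp (-(π * |t|) / 2) / (1 - σ₂)) *
        X ^ (1 - σ) := by
      simp only [hP, norm_mul]
      rw [hXn, ← hw]
      gcongr
    have h0 : 0 ≤ ρ₀ * (Cg * (1 + |t|) * Real.exp (-(π * |t|) / 2) / (1 - σ₂)) * X ^ (1 - σ) := by
      positivity
    calc ‖P t‖ ^ 2 ≤ (ρ₀ * (Cg * (1 + |t|) * Real.exp (-(π * |t|) / 2) / (1 - σ₂)) *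
          X ^ (1 - σ)) ^ 2 := pow_le_pow_left₀ (norm_nonneg _) hPn 2
      _ = M * X ^ (2 - 2 * σ) * ((1 + |t|) ^ (2 : ℝ) * Real.exp (-(π * |t|))) := by
          have e1 : (Real.exp (-(π * |t|) / 2)) ^ 2 = Real.exp (-(π * |t|)) := by
            rw [← Real.exp_nat_mul]; congr 1; push_cast; ring
          have e2 : (X ^ (1 - σ)) ^ 2 = X ^ (2 - 2 * σ) := by
            rw [← Real.rpow_natCast, ← Real.rpow_mul hX0.le]; congr 1; push_cast; ring
          have e3 : (1 + |t|) ^ 2 = (1 + |t|) ^ (2 : ℝ) := by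
            rw [← Real.rpow_natCast]; norm_num
          rw [hM, ← e1, ← e2, ← e3]; ring
  -- integrate over `[-T, T]` and then over `ℝ`
  set F : ℝ → ℝ := fun t ↦ M * X ^ (2 - 2 * σ) * ((1 + |t|) ^ (2 : ℝ) * Real.exp (-(π * |t|)))
    with hF
  have hFint : Integrable F := hIe.const_mul _
  have hFcont : Continuous F := by
    refine continuous_const.mul ((Continuous.rpow_const (by fun_prop)
      fun t ↦ Or.inl (by positivity)).mul (by fun_prop))
  have h1 : ∫ t in (-T)..T, ‖P t‖ ^ 2 ≤ ∫ t in (-T)..T, F t :=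
    intervalIntegral.integral_mono_on hTT ((hPc.norm.pow 2).intervalIntegrable (μ := volume) _ _)
      (hFcont.intervalIntegrable (μ := volume) _ _) (fun t _ ↦ hPt t)
  have h2 : ∫ t in (-T)..T, F t ≤ ∫ t, F t := by
    rw [intervalIntegral.integral_of_le hTT]
    exact setIntegral_le_integral hFint (Eventually.of_forall fun t ↦ by positivity)
  have h3 : ∫ t, F t = M * X ^ (2 - 2 * σ) * Ie := by
    rw [hF, integral_const_mul, hIe_def]
  have hX2 : 0 ≤ X ^ (2 - 2 * σ) := Real.rpow_nonneg hX0.le _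
  calc ∫ t in (-T)..T, ‖P t‖ ^ 2 ≤ M * X ^ (2 - 2 * σ) * Ie := by linarith [h1, h2, h3]
    _ = (M * Ie) * X ^ (2 - 2 * σ) := by ring
    _ ≤ (M * Ie + 1) * X ^ (2 - 2 * σ) := by gcongr; linarith

set_option maxHeartbeats 1600000 in
/-- **The recursive step.** Let `K` be imaginary quadratic, `1/2 < σ₁ ≤ σ₂ < 1`, and let `σ'` be a
NON-integer abscissa with `σ₂ − 1 < σ' < 1/2` satisfying the numerical condition
`(1 − 2σ')(2 − 2σ₁) < σ₁ − σ'`. If the mean square of every `Z_b` (`|b| ≤ 1`) on the dual line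
`Re = 1 − σ'` is `≤ C₁ U`, then the mean square of every `Z_a` on `Re = σ ∈ [σ₁, σ₂]` is `≤ C T`,
uniformly in `a` and `σ`. Proof: `Z_a(s) = D_X(s) − Z₁_a(1)Γ(1−s)X^{1−s} − R(s)` (`smoothedSum_eq`)
with `X = T^λ`, `λ = (1 − 2σ')/(σ₁ − σ')`; `∫|D_X|² ≪ T + X^{2−2σ₁+2ε} ≪ T`
(`meanSquare_smoothedSum_le`, `λ(2 − 2σ₁ + 2ε) ≤ 1`), `∫|Γ-term|² ≪ X^{2−2σ} ≪ T`, and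
`∫|R|² ≪ X^{−2(σ−σ')} T^{3−4σ'} ≤ T` (`meanSquare_remainder_le` fed by `meanSquare_transfer`,
`λ(σ − σ') ≥ 1 − 2σ'`). [cite: Titchmarsh1986, §7.9 (method of the mean-value theorems), adapted] -/
theorem meanSquare_step (h2 : Module.finrank ℚ K = 2) (hd : NumberField.discr K < 0)
    {σ₁ σ₂ σ' : ℝ} (hσ₁ : 1 / 2 < σ₁) (hσ₁₂ : σ₁ ≤ σ₂) (hσ₂ : σ₂ < 1)
    (hσ'1 : σ₂ - 1 < σ') (hσ'2 : σ' < 1 / 2) (hσ'0 : σ' ≠ 0)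
    (hnum : (1 - 2 * σ') * (2 - 2 * σ₁) < σ₁ - σ') {C₁ : ℝ}
    (hC₁ : ∀ b : ClassGroup (𝓞 K) → ℂ, (∀ C, ‖b C‖ ≤ 1) → ∀ U : ℝ, 1 ≤ U →
      ∫ u in (-U)..U, ‖classTwistedZeta K b ((1 - σ' : ℝ) + u * I)‖ ^ 2 ≤ C₁ * U) :
    ∃ C : ℝ, 0 < C ∧ ∀ a : ClassGroup (𝓞 K) → ℂ, (∀ C, ‖a C‖ ≤ 1) →
      ∀ σ : ℝ, σ₁ ≤ σ → σ ≤ σ₂ → ∀ T : ℝ, 1 ≤ T →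
        ∫ t in (-T)..T, ‖classTwistedZeta K a (σ + t * I)‖ ^ 2 ≤ C * T := by
  have hσ'3 : -1 / 2 ≤ σ' := by linarith
  obtain ⟨C₂, hC₂0, hC₂⟩ := meanSquare_transfer h2 hd hσ'3 hσ'2.le hσ'0 hC₁
  set q : ℝ := 3 - 4 * σ' with hq
  have hq0 : 0 ≤ q := by rw [hq]; linarith
  -- ### numerics
  have ha₁0 : 0 < σ₁ - σ' := by linarith
  set lam : ℝ := (1 - 2 * σ') / (σ₁ - σ') with hlam
  have hlam0 : 0 < lam := div_pos (by linarith) ha₁0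
  have hlamkey : lam * (σ₁ - σ') = 1 - 2 * σ' := by rw [hlam]; field_simp
  have hlam1 : lam * (2 - 2 * σ₁) < 1 := by
    rw [hlam, div_mul_eq_mul_div, div_lt_one ha₁0]; linarith
  set ε : ℝ := min ((1 - lam * (2 - 2 * σ₁)) / (2 * lam)) ((σ₁ - 1 / 2) / 2) with hε
  have hε0 : 0 < ε := lt_min (div_pos (by linarith) (by linarith)) (by linarith)
  have hε1 : lam * (2 - 2 * σ₁ + 2 * ε) ≤ 1 := by
    have h : ε ≤ (1 - lam * (2 - 2 * σ₁)) / (2 * lam) := min_le_left _ _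
    rw [le_div_iff₀ (by linarith)] at h
    nlinarith
  have hε2 : 1 / 2 + ε < σ₁ := by
    have h : ε ≤ (σ₁ - 1 / 2) / 2 := min_le_right _ _
    linarith
  obtain ⟨CB, hCB0, hCB⟩ := meanSquare_smoothedSum_le (K := K) hε0 hε2 (by linarith : σ₁ < 1)
  obtain ⟨C₃, hC₃0, hC₃⟩ := meanSquare_remainder_le (K := K) hσ'3 hσ'2.le ha₁0
    (by linarith : σ₁ - σ' ≤ σ₂ - σ') (by linarith : σ₂ - σ' < 1) hq0 hC₂
  -- ### the constant of the `Γ`-term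
  obtain ⟨CP, hCP0, hCP⟩ := exists_meanSquare_poleTerm_le (K := K) hσ₂
  refine ⟨3 * (2 * CB + CP + C₃), by positivity, fun a ha σ hσ1 hσ2 T hT ↦ ?_⟩
  -- ### parameters
  have hT0 : 0 < T := by linarith
  have hTT : -T ≤ T := by linarith
  set X : ℝ := T ^ lam with hX
  have hX1 : 1 ≤ X := Real.one_le_rpow hT hlam0.le
  have hX0 : 0 < X := by linarith
  have hX0' : (X : ℂ) ≠ 0 := by exact_mod_cast hX0.ne'
  set a' : ℝ := σ - σ' with ha'
  have ha'0 : 0 < a' := by rw [ha']; linarith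
  have ha'1 : a' < 1 := by rw [ha']; linarith
  have hs : ∀ t : ℝ, ((σ' + a' : ℝ) : ℂ) + t * I = (σ : ℂ) + t * I := fun t ↦ by
    rw [ha']; push_cast; ring
  -- ### the three pieces
  set Z : ℂ → ℂ := classTwistedZeta K a with hZ_def
  set D : ℝ → ℂ := fun t ↦ ∑' n : ℕ, classCoeff K a n * (n : ℂ) ^ (-((σ : ℂ) + t * I)) *
    (Real.exp (-(n / X)) : ℂ) with hD
  set P : ℝ → ℂ := fun t ↦ classTwistedZeta₁ K a 1 * Complex.Gamma (1 - ((σ : ℂ) + t * I)) *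
    (X : ℂ) ^ (1 - ((σ : ℂ) + t * I)) with hP
  set Rm : ℝ → ℂ := fun t ↦ (1 / (2 * π) : ℂ) * ∫ y : ℝ,
    Z ((σ : ℂ) + t * I + ((-a' : ℝ) + y * I)) * Complex.Gamma ((-a' : ℝ) + y * I) *
      (X : ℂ) ^ (((-a' : ℝ) : ℂ) + y * I) with hRm
  have hid : ∀ t : ℝ, D t = Z (σ + t * I) + P t + Rm t := by
    intro t
    exact smoothedSum_eq (K := K) a ha (s := (σ : ℂ) + t * I) (by simp; linarith)
      (by simp; linarith) ha'0 ha'1 (by simp [ha']; linarith) (by simp [ha']; linarith) hX0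
  -- ### continuity
  have hZc : Continuous fun t : ℝ ↦ Z (σ + t * I) :=
    continuous_classTwistedZeta_vertical (K := K) a (z₀ := σ) (by simp; linarith)
  have hDc : Continuous D := continuous_smoothedSum (K := K) ha (by linarith) hX0
  have hPc : Continuous P := continuous_poleTerm (K := K) a (by linarith) hX0
  have hRc : Continuous Rm := by
    have : Rm = fun t ↦ D t - Z (σ + t * I) - P t := funext fun t ↦ by rw [hid t]; ring
    rw [this]
    exact (hDc.sub hZc).sub hPc
  -- ### pointwise and integrated splitting
  have hpt : ∀ t : ℝ, ‖Z (σ + t * I)‖ ^ 2 ≤ 3 * (‖D t‖ ^ 2 + ‖P t‖ ^ 2 + ‖Rm t‖ ^ 2) := by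
    intro t
    have heq : Z (σ + t * I) = D t - P t - Rm t := by rw [hid t]; ring
    rw [heq]
    have h1 : ‖D t - P t - Rm t‖ ≤ ‖D t‖ + ‖P t‖ + ‖Rm t‖ :=
      calc ‖D t - P t - Rm t‖ ≤ ‖D t - P t‖ + ‖Rm t‖ := norm_sub_le _ _
        _ ≤ ‖D t‖ + ‖P t‖ + ‖Rm t‖ := by gcongr; exact norm_sub_le _ _
    have h0 := norm_nonneg (D t - P t - Rm t)
    nlinarith [norm_nonneg (D t), norm_nonneg (P t), norm_nonneg (Rm t),
      sq_nonneg (‖D t‖ - ‖P t‖), sq_nonneg (‖D t‖ - ‖Rm t‖), sq_nonneg (‖P t‖ - ‖Rm t‖)]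
  have iZ : IntervalIntegrable (fun t : ℝ ↦ ‖Z (σ + t * I)‖ ^ 2) volume (-T) T :=
    (hZc.norm.pow 2).intervalIntegrable (μ := volume) _ _
  have iD : IntervalIntegrable (fun t : ℝ ↦ ‖D t‖ ^ 2) volume (-T) T :=
    (hDc.norm.pow 2).intervalIntegrable (μ := volume) _ _
  have iP : IntervalIntegrable (fun t : ℝ ↦ ‖P t‖ ^ 2) volume (-T) T :=
    (hPc.norm.pow 2).intervalIntegrable (μ := volume) _ _
  have iR : IntervalIntegrable (fun t : ℝ ↦ ‖Rm t‖ ^ 2) volume (-T) T :=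
    (hRc.norm.pow 2).intervalIntegrable (μ := volume) _ _
  have hIZ := intervalIntegral.integral_mono_on hTT iZ (((iD.add iP).add iR).const_mul 3)
    (fun t _ ↦ hpt t)
  have hsplit : ∫ t in (-T)..T, 3 * (‖D t‖ ^ 2 + ‖P t‖ ^ 2 + ‖Rm t‖ ^ 2) =
      3 * ((∫ t in (-T)..T, ‖D t‖ ^ 2) + (∫ t in (-T)..T, ‖P t‖ ^ 2) +
        ∫ t in (-T)..T, ‖Rm t‖ ^ 2) := by
    rw [intervalIntegral.integral_const_mul, intervalIntegral.integral_add (iD.add iP) iR,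
      intervalIntegral.integral_add iD iP]
  -- ### bound for `D`
  have hDb : ∫ t in (-T)..T, ‖D t‖ ^ 2 ≤ 2 * CB * T := by
    have h := hCB a ha σ X T hσ1 hX1 hT
    have hXe : X ^ (2 - 2 * σ₁ + 2 * ε) ≤ T := by
      rw [hX, ← Real.rpow_mul hT0.le]
      calc T ^ (lam * (2 - 2 * σ₁ + 2 * ε)) ≤ T ^ (1 : ℝ) :=
            Real.rpow_le_rpow_of_exponent_le hT hε1
        _ = T := Real.rpow_one T
    calc ∫ t in (-T)..T, ‖D t‖ ^ 2 ≤ CB * (T + X ^ (2 - 2 * σ₁ + 2 * ε)) := h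
      _ ≤ CB * (T + T) := by gcongr
      _ = 2 * CB * T := by ring
  -- ### bound for `P`
  have hPb : ∫ t in (-T)..T, ‖P t‖ ^ 2 ≤ CP * T := by
    have h := hCP a ha σ (by linarith) hσ2 X hX0 T hT0
    have hXe : X ^ (2 - 2 * σ) ≤ T := by
      calc X ^ (2 - 2 * σ) ≤ X ^ (2 - 2 * σ₁) := Real.rpow_le_rpow_of_exponent_le hX1 (by linarith)
        _ = T ^ (lam * (2 - 2 * σ₁)) := by rw [hX, ← Real.rpow_mul hT0.le]
        _ ≤ T ^ (1 : ℝ) := Real.rpow_le_rpow_of_exponent_le hT hlam1.le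
        _ = T := Real.rpow_one T
    calc ∫ t in (-T)..T, ‖P t‖ ^ 2 ≤ CP * X ^ (2 - 2 * σ) := h
      _ ≤ CP * T := by gcongr
  -- ### bound for `R`
  have hRb : ∫ t in (-T)..T, ‖Rm t‖ ^ 2 ≤ C₃ * T := by
    have h := hC₃ a ha a' X T (by rw [ha']; linarith) (by rw [ha']; linarith) hX0 hT
    simp_rw [hs] at h
    have hexp : X ^ (-(2 * a')) * T ^ q ≤ T := by
      rw [hX, ← Real.rpow_mul hT0.le, ← Real.rpow_add hT0]
      calc T ^ (lam * -(2 * a') + q) ≤ T ^ (1 : ℝ) := by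
            refine Real.rpow_le_rpow_of_exponent_le hT ?_
            have : lam * (σ₁ - σ') ≤ lam * a' := by
              rw [ha']; exact mul_le_mul_of_nonneg_left (by linarith) hlam0.le
            rw [hq]; nlinarith [hlamkey]
        _ = T := Real.rpow_one T
    calc ∫ t in (-T)..T, ‖Rm t‖ ^ 2 ≤ C₃ * X ^ (-(2 * a')) * T ^ q := h
      _ = C₃ * (X ^ (-(2 * a')) * T ^ q) := by ring
      _ ≤ C₃ * T := by gcongr
  -- ### conclusion
  calc ∫ t in (-T)..T, ‖Z (σ + t * I)‖ ^ 2
      ≤ ∫ t in (-T)..T, 3 * (‖D t‖ ^ 2 + ‖P t‖ ^ 2 + ‖Rm t‖ ^ 2) := hIZ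
    _ = 3 * ((∫ t in (-T)..T, ‖D t‖ ^ 2) + (∫ t in (-T)..T, ‖P t‖ ^ 2) +
        ∫ t in (-T)..T, ‖Rm t‖ ^ 2) := hsplit
    _ ≤ 3 * (2 * CB * T + CP * T + C₃ * T) := by gcongr
    _ = 3 * (2 * CB + CP + C₃) * T := by ring

/-! ### The iteration `τ ↦ (3τ − 1)/(4τ − 1)` and the main theorem -/

/-- **Applying the step below a known region.** Let `1/2 < τ ≤ 1` and suppose every line
`Re = σ'' > τ`, `σ'' ≠ 1`, carries the bound `∫_{−U}^{U}|Z_b(σ''+iu)|² ≤ C₁(σ'') U` (`|b| ≤ 1`,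
`U ≥ 1`). Then the mean square is `≤ C T` uniformly on every strip `[σ₁, σ₂]` with
`(3τ − 1)/(4τ − 1) < σ₁ ≤ σ₂ < 1` (choose `σ' = 1 − τ − η` in `meanSquare_step`, the dual line
`τ + η` lying in the known region). [folklore] -/
theorem meanSquare_of_lines (h2 : Module.finrank ℚ K = 2) (hd : NumberField.discr K < 0)
    {τ : ℝ} (hτ1 : 1 / 2 < τ) (hτ2 : τ ≤ 1)
    (hQ : ∀ σ'' : ℝ, τ < σ'' → σ'' ≠ 1 → ∃ C₁ : ℝ, 0 < C₁ ∧
      ∀ b : ClassGroup (𝓞 K) → ℂ, (∀ C, ‖b C‖ ≤ 1) → ∀ U : ℝ, 1 ≤ U →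
        ∫ u in (-U)..U, ‖classTwistedZeta K b (σ'' + u * I)‖ ^ 2 ≤ C₁ * U)
    {σ₁ σ₂ : ℝ} (hσ₁ : (3 * τ - 1) / (4 * τ - 1) < σ₁) (hσ₁₂ : σ₁ ≤ σ₂) (hσ₂ : σ₂ < 1) :
    ∃ C : ℝ, 0 < C ∧ ∀ a : ClassGroup (𝓞 K) → ℂ, (∀ C, ‖a C‖ ≤ 1) →
      ∀ σ : ℝ, σ₁ ≤ σ → σ ≤ σ₂ → ∀ T : ℝ, 1 ≤ T →
        ∫ t in (-T)..T, ‖classTwistedZeta K a (σ + t * I)‖ ^ 2 ≤ C * T := by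
  have h4τ : 0 < 4 * τ - 1 := by linarith
  -- `σ₁ > 1/2` and the key negativity `g₀ < 0`
  set g₀ : ℝ := σ₁ * (1 - 4 * τ) + 3 * τ - 1 with hg₀
  have hg₀neg : g₀ < 0 := by
    rw [div_lt_iff₀ h4τ] at hσ₁; rw [hg₀]; nlinarith
  have hσ₁' : 1 / 2 < σ₁ := by
    have : (1 / 2 : ℝ) ≤ (3 * τ - 1) / (4 * τ - 1) := by
      rw [le_div_iff₀ h4τ]; linarith
    linarith
  -- the small parameter `η`
  set c : ℝ := |3 - 4 * σ₁| with hc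
  have hc0 : 0 ≤ c := abs_nonneg _
  set η₀ : ℝ := min ((2 - τ - σ₂) / 2) ((-g₀) / (2 * c + 1)) with hη₀
  have hη₀0 : 0 < η₀ := lt_min (by linarith) (div_pos (by linarith) (by linarith))
  -- `η = η₀` if `τ = 1`, `η = min η₀ ((1 - τ)/2)` if `τ < 1`
  obtain ⟨η, hη0, hηle, hητ⟩ : ∃ η : ℝ, 0 < η ∧ η ≤ η₀ ∧ (τ < 1 → η ≤ (1 - τ) / 2) := by
    rcases eq_or_lt_of_le hτ2 with h | h
    · exact ⟨η₀, hη₀0, le_rfl, fun h' ↦ absurd h (ne_of_lt h')⟩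
    · exact ⟨min η₀ ((1 - τ) / 2), lt_min hη₀0 (by linarith), min_le_left _ _,
        fun _ ↦ min_le_right _ _⟩
  have hη1 : η ≤ (2 - τ - σ₂) / 2 := hηle.trans (min_le_left _ _)
  have hη2 : η ≤ (-g₀) / (2 * c + 1) := hηle.trans (min_le_right _ _)
  -- the abscissa `σ' = 1 - τ - η`
  set σ' : ℝ := 1 - τ - η with hσ'
  have hσ'1 : σ₂ - 1 < σ' := by rw [hσ']; linarith
  have hσ'2 : σ' < 1 / 2 := by rw [hσ']; linarith
  have hσ'0 : σ' ≠ 0 := by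
    rcases eq_or_lt_of_le hτ2 with h | h
    · rw [hσ', h]; intro h0; linarith
    · have := hητ h; rw [hσ']; intro h0; linarith
  -- the numerical condition
  have hnum : (1 - 2 * σ') * (2 - 2 * σ₁) < σ₁ - σ' := by
    have hexp : (1 - 2 * σ') * (2 - 2 * σ₁) - (σ₁ - σ') = g₀ + η * (3 - 4 * σ₁) := by
      rw [hσ', hg₀]; ring
    have h1 : η * (3 - 4 * σ₁) ≤ η * c := mul_le_mul_of_nonneg_left (le_abs_self _) hη0.le
    have h2 : η * (2 * c + 1) ≤ -g₀ := by rwa [le_div_iff₀ (by linarith)] at hη2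
    nlinarith
  -- the dual line `1 - σ' = τ + η` lies in the known region
  have hdual : τ < 1 - σ' := by rw [hσ']; linarith
  have hdual1 : 1 - σ' ≠ 1 := by
    rcases eq_or_lt_of_le hτ2 with h | h
    · rw [hσ', h]; intro h0; linarith
    · have := hητ h; rw [hσ']; intro h0; linarith
  obtain ⟨C₁, -, hC₁⟩ := hQ (1 - σ') hdual hdual1
  have hC₁' : ∀ b : ClassGroup (𝓞 K) → ℂ, (∀ C, ‖b C‖ ≤ 1) → ∀ U : ℝ, 1 ≤ U →
      ∫ u in (-U)..U, ‖classTwistedZeta K b ((1 - σ' : ℝ) + u * I)‖ ^ 2 ≤ C₁ * U := by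
    intro b hb U hU
    have := hC₁ b hb U hU
    simpa using this
  exact meanSquare_step h2 hd hσ₁' hσ₁₂ hσ₂ hσ'1 hσ'2 hσ'0 hnum hC₁'

/-- **All lines `Re = σ'' > (k+1)/(2k+1)`, `σ'' ≠ 1`, have linear mean square** (induction on `k`:
`k = 0` is the half-plane of absolute convergence; the step is `meanSquare_of_lines`, since
`(3τ_k − 1)/(4τ_k − 1) = τ_{k+1}` for `τ_k = (k+1)/(2k+1)`). [folklore] -/
theorem meanSquare_lines (h2 : Module.finrank ℚ K = 2) (hd : NumberField.discr K < 0) (k : ℕ) :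
    ∀ σ'' : ℝ, ((k : ℝ) + 1) / (2 * k + 1) < σ'' → σ'' ≠ 1 → ∃ C₁ : ℝ, 0 < C₁ ∧
      ∀ b : ClassGroup (𝓞 K) → ℂ, (∀ C, ‖b C‖ ≤ 1) → ∀ U : ℝ, 1 ≤ U →
        ∫ u in (-U)..U, ‖classTwistedZeta K b (σ'' + u * I)‖ ^ 2 ≤ C₁ * U := by
  induction k with
  | zero =>
    intro σ'' hσ'' _
    simp only [Nat.cast_zero, zero_add, mul_zero, div_one] at hσ''
    exact meanSquare_line_of_one_lt hσ''
  | succ k ih =>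
    intro σ'' hσ'' hσ''1
    set τ : ℝ := ((k : ℝ) + 1) / (2 * k + 1) with hτ
    have hk0 : (0 : ℝ) ≤ k := Nat.cast_nonneg k
    have hτ1 : 1 / 2 < τ := by rw [hτ, lt_div_iff₀ (by linarith)]; linarith
    have hτ2 : τ ≤ 1 := by rw [hτ, div_le_one (by linarith)]; linarith
    by_cases hgt : τ < σ''
    · exact ih σ'' hgt hσ''1
    · have hgt' : σ'' ≤ τ := not_lt.mp hgt
      have hlt1 : σ'' < 1 := lt_of_le_of_ne (hgt'.trans hτ2) hσ''1
      have h21 : (2 * (k : ℝ) + 1) ≠ 0 := by positivity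
      have e1 : 3 * τ - 1 = ((k : ℝ) + 2) / (2 * k + 1) := by rw [hτ]; field_simp; ring
      have e2 : 4 * τ - 1 = (2 * (k : ℝ) + 3) / (2 * k + 1) := by rw [hτ]; field_simp; ring
      have hφ : (3 * τ - 1) / (4 * τ - 1) = ((k : ℝ) + 2) / (2 * k + 3) := by
        rw [e1, e2, div_div_div_cancel_right₀ h21]
      have hcast : (((k + 1 : ℕ) : ℝ)) = (k : ℝ) + 1 := by push_cast; ring
      rw [hcast] at hσ''
      have e3 : ((k : ℝ) + 1 + 1) / (2 * ((k : ℝ) + 1) + 1) = ((k : ℝ) + 2) / (2 * k + 3) := by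
        congr 1 <;> ring
      have hσ₁ : (3 * τ - 1) / (4 * τ - 1) < σ'' := by rw [hφ, ← e3]; exact hσ''
      obtain ⟨C, hC0, hC⟩ := meanSquare_of_lines h2 hd hτ1 hτ2 ih hσ₁ le_rfl hlt1
      exact ⟨C, hC0, fun b hb U hU ↦ hC b hb σ'' le_rfl le_rfl U hU⟩

/-- **Mean square of the class-twisted zeta functions in the strip `1/2 < σ < 1` (imaginary
quadratic fields).** For `[K:ℚ] = 2`, `d_K < 0` and `1/2 < σ₁ ≤ σ₂ < 1` there is `C` such that
for every coefficient function `a : Cl_K → ℂ` with `|a| ≤ 1`, every `σ ∈ [σ₁, σ₂]` and every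
`T ≥ 1`,

`∫_{−T}^{T} |Z_a(σ + it)|² dt ≤ C · T`, `Z_a(s) = Σ_C a(C) ζ(C, s)`.

In particular this holds for the class partial zeta functions `ζ(C, s)`, the class group
`L`-functions `L(s, χ)` (`classGroupLFunction_meanSquare_le`) and `ζ_K` — degree-2 `L`-functions
over `ℚ`, for which `σ > 1/2 = 1 − 1/degree` is the classical mean-square half-plane
(Potter 1940; Chandrasekharan–Narasimhan 1963; Steuding, Thm. 2.4 / Cor. 6.11 for the polynomial
Euler product class). The proof here is the `σ`-iteration `meanSquare_lines` /
`meanSquare_of_lines` built on the Mellin smoothing `smoothedSum_eq`, the functional equation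
(`meanSquare_transfer`) and the Montgomery–Vaughan mean value theorem
(`meanSquare_smoothedSum_le`), not the printed approximate functional equation.
[cite: Steuding2007, Thm. 2.4 and Cor. 6.11 (mean-square half-plane σ_m ≤ max(1/2, 1 − 1/d_L))] -/
theorem classTwistedZeta_meanSquare_le (h2 : Module.finrank ℚ K = 2) (hd : NumberField.discr K < 0)
    {σ₁ σ₂ : ℝ} (hσ₁ : 1 / 2 < σ₁) (hσ₁₂ : σ₁ ≤ σ₂) (hσ₂ : σ₂ < 1) :
    ∃ C : ℝ, 0 < C ∧ ∀ a : ClassGroup (𝓞 K) → ℂ, (∀ C, ‖a C‖ ≤ 1) →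
      ∀ σ : ℝ, σ₁ ≤ σ → σ ≤ σ₂ → ∀ T : ℝ, 1 ≤ T →
        ∫ t in (-T)..T, ‖classTwistedZeta K a (σ + t * I)‖ ^ 2 ≤ C * T := by
  -- choose `k` with `τ_{k+1} = (k+2)/(2k+3) < σ₁`
  obtain ⟨k, hk⟩ := exists_nat_gt (1 / (2 * (σ₁ - 1 / 2)))
  have hk0 : (0 : ℝ) ≤ k := Nat.cast_nonneg k
  set τ : ℝ := ((k : ℝ) + 1) / (2 * k + 1) with hτ
  have hτ1 : 1 / 2 < τ := by rw [hτ, lt_div_iff₀ (by linarith)]; linarith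
  have hτ2 : τ ≤ 1 := by rw [hτ, div_le_one (by linarith)]; linarith
  have h21 : (2 * (k : ℝ) + 1) ≠ 0 := by positivity
  have e1 : 3 * τ - 1 = ((k : ℝ) + 2) / (2 * k + 1) := by rw [hτ]; field_simp; ring
  have e2 : 4 * τ - 1 = (2 * (k : ℝ) + 3) / (2 * k + 1) := by rw [hτ]; field_simp; ring
  have hφ : (3 * τ - 1) / (4 * τ - 1) = ((k : ℝ) + 2) / (2 * k + 3) := by
    rw [e1, e2, div_div_div_cancel_right₀ h21]
  have hσ₁' : (3 * τ - 1) / (4 * τ - 1) < σ₁ := by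
    rw [hφ, div_lt_iff₀ (by linarith)]
    have hpos : 0 < σ₁ - 1 / 2 := by linarith
    rw [div_lt_iff₀ (by linarith)] at hk
    nlinarith
  exact meanSquare_of_lines h2 hd hτ1 hτ2 (meanSquare_lines h2 hd k) hσ₁' hσ₁₂ hσ₂

/-- **Mean square of the class group `L`-functions of an imaginary quadratic field in the strip**:
for `1/2 < σ₁ ≤ σ₂ < 1` there is `C` with `∫_{−T}^{T} |L(σ + it, χ)|² dt ≤ C T` for every class
group character `χ`, every `σ ∈ [σ₁, σ₂]` and every `T ≥ 1` (the case `a = χ` of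
`classTwistedZeta_meanSquare_le`; for `χ = 1` this is `ζ_K`).
[cite: Steuding2007, Thm. 2.4 and Cor. 6.11 (mean-square half-plane)] -/
theorem classGroupLFunction_meanSquare_le (h2 : Module.finrank ℚ K = 2)
    (hd : NumberField.discr K < 0) {σ₁ σ₂ : ℝ} (hσ₁ : 1 / 2 < σ₁) (hσ₁₂ : σ₁ ≤ σ₂)
    (hσ₂ : σ₂ < 1) :
    ∃ C : ℝ, 0 < C ∧ ∀ χ : ClassGroup (𝓞 K) →* ℂˣ,
      ∀ σ : ℝ, σ₁ ≤ σ → σ ≤ σ₂ → ∀ T : ℝ, 1 ≤ T →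
        ∫ t in (-T)..T, ‖classGroupLFunction K χ (σ + t * I)‖ ^ 2 ≤ C * T := by
  obtain ⟨C, hC0, hC⟩ := classTwistedZeta_meanSquare_le h2 hd hσ₁ hσ₁₂ hσ₂
  refine ⟨C, hC0, fun χ σ hσ1 hσ2 T hT ↦ ?_⟩
  have h := hC (fun C ↦ (χ C : ℂ)) (fun C ↦ (norm_classGroupChar_apply χ C).le) σ hσ1 hσ2 T hT
  simpa [classGroupLFunction_eq_classTwistedZeta] using h

end Literature.NumberTheory.LFunctions.NumberField
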